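import Literature.NumberTheory.Sieve.MoebiusShiftedPrimesMinorArcForm
import Literature.NumberTheory.Sieve.MoebiusShiftedPrimesMinorArcTools
import Literature.NumberTheory.Sieve.PrimePairsSieveBound
import HarnessLib

/-!
# Möbius on shifted primes — the minor arc bound of Lichtman 2020 (§3.1), proved

Topic `Literature/NumberTheory/Sieve`.  This file PROVES the key minor arc estimate, Proposition 3.1
of J. D. Lichtman, *Averages of the Möbius function on shifted primes*, arXiv:2009.08969
[Lichtman2020] (pp. 9–10 of the held copy `paper:arxiv-2009.08969`), in the vendored form
`Literature.NumberTheory.Sieve.Lichtman2020_minorArcEstimate` of `MoebiusShiftedPrimesArcs.lean`, and so reduces Lichtman's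
Theorem 1.1 (`Literature.NumberTheory.Sieve.lichtman2020_moebius_shifted_primes_avg`, `MoebiusShiftedPrimes.lean`) to the single
remaining named fact `Literature.NumberTheory.Sieve.Lichtman2020_majorArcEstimate` (Proposition 3.2, the major arcs):

* `Lichtman2020.minorArc_sum_le` — PROVED, the bound of §3.1 at a fixed `X` in discrete form: for
  `2 ≤ W`, `1 ≤ d ≤ W`, `P₁ = W³³`, `Q₁ = H/W⁴ < P₂`, `3 ≤ H ≤ X`, `g` completely multiplicative with
  `|g| ≤ 1` and `α ∈ 𝔪(W, Q₁)`,
  `∑_{k ≤ X} |∑_{n ∈ [k, k+H) ∩ dℕ ∩ S, n = dm} g(m) e(mα)| ≤ 600 · HX log H/(d√W)`.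
  Architecture as printed (pp. 9–10): Ramaré's identity (3.2) over the primes `p ∈ [P₁, Q₁]`
  (`norm_twistedSum_sub_ramare_le`, error `ramare_error_le`), dyadic blocks `p ∈ [2^j, 2^{j+1})`,
  duality and Cauchy–Schwarz (3.4)–(3.5) (`core_block_bound`), expansion and geometric series (3.6)
  (`sum_sum_geomBound_sub_le`), Vinogradov's Lemma 3.3 on `𝔪`
  (`sum_geomBound_le_of_mem_minorArcs`, `MoebiusShiftedPrimesMinorArcTools.lean`) and Chebyshev's bound
  for the number of primes in a block (`primeCounting_le_six_mul_div_log`, `PrimePairsSieveBound.lean`).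
  Deviation from the printed proof: the prime-pair sieve bound `#{p₁ - p₂ = n} ≪ (n/φ(n)) P/(log P)²`
  [Opera de Cribro] inserted in (3.6) is replaced by the trivial injectivity count (each difference
  `n` is attained at most once for fixed `p₁`), and the logarithm of the explicit Vinogradov lemma is
  kept; this costs powers of `log H` but gains nothing worse than the shape `HX log H/(d√W)`, which
  still implies Proposition 3.1 as printed (below).
* `Lichtman2020.minorArc_integral_le` — PROVED, the same eventually in `X` for the integral
  `∫₀^X |∑_{x ≤ nd ≤ x+H, n ∈ S_d} g(n) e(nα)| dx` in the regime of Proposition 3.1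
  (`A > 0`, `δ ≥ 0`, `ψ → ∞`, `H ≤ exp((log X)^{2/3})`, `W = (log X)^A`, `Q₁ = H/W⁴`).
* `Lichtman2020_minorArcEstimate_holds : Lichtman2020_minorArcEstimate` — PROVED (Proposition 3.1 as
  vendored: bound `C · HX/(d^{3/4} W^{1/5})`), since `log H ≤ (log X)^{2/3} ≤ W^{3/10}` for `A > 5`.
* `Lichtman2020_keyFourierEstimateLiouville'_of_majorArcEstimate`,
  `Lichtman2020_keyFourierEstimate_of_majorArcEstimate`,
  `lichtman2020_moebius_shifted_primes_avg_of_majorArcEstimate` — PROVED: Proposition 3.2 alone now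
  gives Proposition 2.3 (regime form), Theorem 2.2 and Theorem 1.1 (qualitative part), through
  `MoebiusShiftedPrimesArcs.lean` and the proved sieve bound (2.5) of `MoebiusShiftedPrimesSieveBound.lean`.

## Source

* J. D. Lichtman, *Averages of the Möbius function on shifted primes*, arXiv:2009.08969, §3.1
  pp. 9–10 (proof of Proposition 3.1: (3.1)–(3.6), Lemma 3.3), §3 p. 9 (Propositions 3.1, 3.2).
* M. B. Nathanson, *Additive Number Theory: The Classical Bases*, Lemma 4.10 (Vinogradov's lemma, via
  `VinogradovExpSumTools.lean`).
-/

open Finset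
open scoped FourierTransform

namespace Literature.NumberTheory.Sieve.Lichtman2020

/-! ### Windows divided by a product -/

/-- `m (dp)` lies in the window iff `(mp) d` does. [folklore] -/
theorem mem_windowDiv_mul {d p H k m : ℕ} (hk : 1 ≤ k) :
    m ∈ windowDiv (d * p) H k ↔ m * p ∈ windowDiv d H k := by
  rw [mem_windowDiv hk, mem_windowDiv hk, show m * p * d = m * (d * p) by ring]

/-- Re-indexing `n = mp`: the multiples of `p` in `windowDiv d H k` are the `mp`,
`m ∈ windowDiv (dp) H k`. [folklore] -/
theorem sum_windowDiv_filter_dvd {d p H k : ℕ} (hk : 1 ≤ k) (hp : 0 < p) (f : ℕ → ℂ) :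
    ∑ n ∈ (windowDiv d H k).filter (p ∣ ·), f n = ∑ m ∈ windowDiv (d * p) H k, f (m * p) := by
  symm
  refine Finset.sum_nbij' (fun m => m * p) (fun n => n / p) ?_ ?_ ?_ ?_ ?_
  · intro m hm
    rw [Finset.mem_filter]
    exact ⟨(mem_windowDiv_mul hk).mp hm, Dvd.intro_left _ rfl⟩
  · intro n hn
    rw [Finset.mem_filter] at hn
    obtain ⟨q, rfl⟩ := hn.2
    rw [Nat.mul_div_cancel_left q hp, mem_windowDiv_mul hk, mul_comm]
    exact hn.1
  · intro m _
    exact Nat.mul_div_cancel m hp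
  · intro n hn
    rw [Finset.mem_filter] at hn
    obtain ⟨q, rfl⟩ := hn.2
    rw [Nat.mul_div_cancel_left q hp, mul_comm]
  · intro m _
    rfl

/-- The divided window is an interval: `windowDiv e H k = [⌈k/e⌉, ⌊(k+H-1)/e⌋]`. [folklore] -/
private theorem windowDiv_eq_Icc {e H k : ℕ} (hk : 1 ≤ k) (he : 1 ≤ e) :
    windowDiv e H k = Icc ((k + e - 1) / e) ((k + H - 1) / e) := by
  ext m
  rw [mem_windowDiv hk, Finset.mem_Icc]
  have he0 : 0 < e := he
  constructor
  · rintro ⟨h1, h2⟩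
    refine ⟨?_, (Nat.le_div_iff_mul_le he0).mpr h2⟩
    have h5 : k + e - 1 < (m + 1) * e := by rw [Nat.add_mul, one_mul]; omega
    exact Nat.lt_succ_iff.mp ((Nat.div_lt_iff_lt_mul he0).mpr h5)
  · rintro ⟨h1, h2⟩
    refine ⟨?_, (Nat.le_div_iff_mul_le he0).mp h2⟩
    have h3 : (k + e - 1) / e * e ≤ m * e := Nat.mul_le_mul_right e h1
    have h4 := Nat.lt_div_mul_add (a := k + e - 1) he0
    omega

/-- `⌈k/e⌉ ≥ 1` for `k ≥ 1`. [folklore] -/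
theorem one_le_div_windowDiv {e k : ℕ} (hk : 1 ≤ k) (he : 1 ≤ e) : 1 ≤ (k + e - 1) / e := by
  rw [Nat.le_div_iff_mul_le he]
  omega

/-- `#windowDiv e H k ≤ (H-1)/e + 1`. [folklore] -/
theorem card_windowDiv_le {e H k : ℕ} (hk : 1 ≤ k) (he : 1 ≤ e) :
    #(windowDiv e H k) ≤ (H - 1) / e + 1 := by
  rw [Literature.NumberTheory.Sieve.Lichtman2020.windowDiv_eq_Icc hk he, Nat.card_Icc]
  have he0 : 0 < e := he
  have ha : k ≤ (k + e - 1) / e * e := by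
    have h4 := Nat.lt_div_mul_add (a := k + e - 1) he0
    omega
  have hb : (k + H - 1) / e * e ≤ k + H - 1 := Nat.div_mul_le_self _ _
  have hba : (k + H - 1) / e - (k + e - 1) / e ≤ (H - 1) / e := by
    rw [Nat.le_div_iff_mul_le he0, Nat.sub_mul]
    omega
  omega

/-- Elements of one window are `(H-1)`-close after scaling: `m, m' ∈ windowDiv e H k` gives
`m' e ≤ m e + (H - 1)`. [folklore] -/
theorem mul_le_of_mem_windowDiv {e H k m m' : ℕ} (hk : 1 ≤ k) (hm : m ∈ windowDiv e H k)
    (hm' : m' ∈ windowDiv e H k) : m' * e ≤ m * e + (H - 1) := by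
  rw [mem_windowDiv hk] at hm hm'
  omega

/-! ### Geometric sums over an interval -/

/-- `[a₁, b₁] ∩ [a₂, b₂] = [max a₁ a₂, min b₁ b₂]` in `ℕ`. [folklore] -/
theorem Icc_inter_Icc_nat (a₁ b₁ a₂ b₂ : ℕ) :
    Icc a₁ b₁ ∩ Icc a₂ b₂ = Icc (max a₁ a₂) (min b₁ b₂) := by
  ext m
  simp only [Finset.mem_inter, Finset.mem_Icc, max_le_iff, le_min_iff]
  tauto

/-- `|∑_{a ≤ n ≤ b} e(nx)| ≤ min(V, 1/(2‖x‖))` when `b + 1 - a ≤ V` and `a ≥ 1`. [folklore] -/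
theorem norm_sum_Icc_fourierChar_le_geomBound' {a b : ℕ} (ha : 1 ≤ a) {V : ℝ} (x : ℝ)
    (hV : ((b + 1 - a : ℕ) : ℝ) ≤ V) :
    ‖∑ n ∈ Icc a b, (𝐞 ((n : ℝ) * x) : ℂ)‖ ≤ Vinogradov.geomBound V x := by
  have h : Icc a b = Ioc (a - 1) b := by
    ext n; simp only [Finset.mem_Icc, Finset.mem_Ioc]; omega
  rw [h]
  apply Vinogradov.norm_sum_Ioc_fourierChar_le_geomBound
  rwa [show b - (a - 1) = b + 1 - a by omega]

/-! ### Cauchy–Schwarz and the expansion of a mean square -/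

/-- `∑_{m ∈ T} |B(m)| ≤ √(#T · ∑_{m ∈ T} |B(m)|²)`. [folklore] -/
theorem sum_norm_le_sqrt_card_mul (T : Finset ℕ) (B : ℕ → ℂ) :
    ∑ m ∈ T, ‖B m‖ ≤ Real.sqrt (#T * ∑ m ∈ T, ‖B m‖ ^ 2) := by
  have h0 : 0 ≤ ∑ m ∈ T, ‖B m‖ := Finset.sum_nonneg fun m _ => norm_nonneg _
  have hcs := Finset.sum_mul_sq_le_sq_mul_sq T (fun _ => (1 : ℝ)) (fun m => ‖B m‖)
  simp only [one_mul, one_pow, Finset.sum_const, nsmul_eq_mul, mul_one] at hcs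
  calc ∑ m ∈ T, ‖B m‖ = Real.sqrt ((∑ m ∈ T, ‖B m‖) ^ 2) := (Real.sqrt_sq h0).symm
    _ ≤ Real.sqrt (#T * ∑ m ∈ T, ‖B m‖ ^ 2) := Real.sqrt_le_sqrt hcs

/-- Expansion of a mean square: `∑_{m ∈ T} |∑_{i ∈ I} t_i(m)|² ≤ ∑_{i,j ∈ I} |∑_{m ∈ T} t_i(m) conj t_j(m)|`.
[folklore] -/
theorem sum_norm_sq_sum_le {ι : Type*} (I : Finset ι) (T : Finset ℕ) (t : ι → ℕ → ℂ) :
    ∑ m ∈ T, ‖∑ i ∈ I, t i m‖ ^ 2 ≤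
      ∑ i ∈ I, ∑ j ∈ I, ‖∑ m ∈ T, t i m * (starRingEnd ℂ) (t j m)‖ := by
  have h1 : ∀ m, (‖∑ i ∈ I, t i m‖ ^ 2 : ℝ) =
      (∑ i ∈ I, ∑ j ∈ I, t i m * (starRingEnd ℂ) (t j m)).re := by
    intro m
    rw [← Finset.sum_mul_sum, ← map_sum, Complex.mul_conj, Complex.ofReal_re,
      Complex.normSq_eq_norm_sq]
  simp_rw [h1]
  rw [← Complex.re_sum, Finset.sum_comm]
  refine (Complex.re_le_norm _).trans ?_
  refine (norm_sum_le _ _).trans (Finset.sum_le_sum fun i _ => ?_)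
  rw [Finset.sum_comm]
  exact norm_sum_le _ _

/-! ### Counting the pairs of windows that share an element -/

/-- If `m e₁, m₀ e₁` are `(H-1)`-close and `e₂ ≤ 2 e₁` then `m e₂ ≤ m₀ e₂ + 2(H-1)`. [folklore] -/
theorem mul_le_mul_add_of_close {m m₀ e₁ e₂ H : ℕ} (he : e₂ ≤ 2 * e₁)
    (h : m * e₁ ≤ m₀ * e₁ + (H - 1)) : m * e₂ ≤ m₀ * e₂ + 2 * (H - 1) := by
  rcases le_or_gt m₀ m with hle | hlt
  · have h1 : (m - m₀) * e₁ ≤ H - 1 := by rw [Nat.sub_mul]; omega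
    have h2 : (m - m₀) * e₂ ≤ (m - m₀) * (2 * e₁) := Nat.mul_le_mul_left _ he
    have h3 : (m - m₀) * (2 * e₁) = 2 * ((m - m₀) * e₁) := by ring
    have h4 : m * e₂ = (m - m₀) * e₂ + m₀ * e₂ := by rw [← Nat.add_mul, Nat.sub_add_cancel hle]
    omega
  · have : m * e₂ ≤ m₀ * e₂ := Nat.mul_le_mul_right _ hlt.le
    omega

/-- For `p₂ ≤ 2p₁` and a fixed `k₁ ≥ 1`, at most `5H` values of `k₂` have
`windowDiv (dp₁) H k₁ ∩ windowDiv (dp₂) H k₂ ≠ ∅` ("`O(H)` subsequent choices for `x₂` since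
`x₂ = x₁ (p₂/p₁) + O(H)`", p. 10). [cite: Lichtman2020, §3.1, p. 10] -/
theorem card_filter_windowDiv_inter_nonempty_le {d H X p₁ p₂ k₁ : ℕ} (hk₁ : 1 ≤ k₁)
    (hp : p₂ ≤ 2 * p₁) :
    #((Icc 1 X).filter fun k₂ =>
        (windowDiv (d * p₁) H k₁ ∩ windowDiv (d * p₂) H k₂).Nonempty) ≤ 5 * H := by
  rcases (windowDiv (d * p₁) H k₁).eq_empty_or_nonempty with h0 | ⟨m₀, hm₀⟩
  · rw [Finset.filter_false_of_mem, Finset.card_empty]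
    · exact Nat.zero_le _
    · intro k₂ _ h
      rw [h0, Finset.empty_inter] at h
      exact Finset.not_nonempty_empty h
  · have hm₀' := (mem_windowDiv hk₁).mp hm₀
    have he : d * p₂ ≤ 2 * (d * p₁) := by
      calc d * p₂ ≤ d * (2 * p₁) := Nat.mul_le_mul_left d hp
        _ = 2 * (d * p₁) := by ring
    calc #((Icc 1 X).filter fun k₂ =>
            (windowDiv (d * p₁) H k₁ ∩ windowDiv (d * p₂) H k₂).Nonempty)
        ≤ #(Icc (m₀ * (d * p₂) - 3 * (H - 1)) (m₀ * (d * p₂) + 2 * (H - 1))) := by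
          apply Finset.card_le_card
          intro k₂ hk₂
          rw [Finset.mem_filter, Finset.mem_Icc] at hk₂
          obtain ⟨⟨hk₂1, -⟩, m, hm⟩ := hk₂
          rw [Finset.mem_inter] at hm
          have h1 := (mem_windowDiv hk₁).mp hm.1
          have h2 := (mem_windowDiv hk₂1).mp hm.2
          have h3 : m * (d * p₂) ≤ m₀ * (d * p₂) + 2 * (H - 1) :=
            mul_le_mul_add_of_close he (by omega)
          have h4 : m₀ * (d * p₂) ≤ m * (d * p₂) + 2 * (H - 1) :=
            mul_le_mul_add_of_close he (by omega)
          rw [Finset.mem_Icc]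
          omega
      _ = m₀ * (d * p₂) + 2 * (H - 1) + 1 - (m₀ * (d * p₂) - 3 * (H - 1)) := Nat.card_Icc _ _
      _ ≤ 5 * H := by omega

/-! ### The core estimate for one dyadic block -/

/-- **The core of §3.1 for one dyadic block** (pp. 9–10: "by the trivial bound and Cauchy–Schwarz
… We expand the left hand side of (3.5) and sum the resulting geometric series on `m` … there are
`O(X)` choices for `x₁` and `O(H)` subsequent choices for `x₂`"), in discrete form.  For `d, H, P ≥ 1`,
a finite set `Q ⊆ [P, 2P)`, coefficients `|c(m)|, |w(p)| ≤ 1` and `α ∈ ℝ`,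
`∑_{k ≤ X} |∑_{p ∈ Q} ∑_{m : mp d ∈ [k, k+H)} c(m) w(p) e(mpα)|
  ≤ √( M · 5HX · ∑_{p₁,p₂ ∈ Q} min(U, 1/(2‖(p₁-p₂)α‖)) )`,
`M = ⌊(X+H-1)/(dP)⌋`, `U = ⌊(H-1)/(dP)⌋ + 1` (duality `|G(k)| = θ_k G(k)`, Cauchy–Schwarz over
`m ≤ M`, expansion, geometric sums over `windowDiv (dp₁) H k₁ ∩ windowDiv (dp₂) H k₂`, and
`card_filter_windowDiv_inter_nonempty_le`). [cite: Lichtman2020, §3.1, (3.4)–(3.5)] -/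
theorem core_block_bound {d H X P : ℕ} (hd : 1 ≤ d) (hP : 1 ≤ P)
    (Q : Finset ℕ) (hQ : ∀ p ∈ Q, P ≤ p ∧ p < 2 * P)
    (c w : ℕ → ℂ) (hc : ∀ m, ‖c m‖ ≤ 1) (hw : ∀ p, ‖w p‖ ≤ 1) (α : ℝ) :
    ∑ k ∈ Icc 1 X, ‖∑ p ∈ Q, ∑ m ∈ windowDiv (d * p) H k,
        c m * w p * (𝐞 (((m * p : ℕ) : ℝ) * α) : ℂ)‖ ≤
      Real.sqrt ((((X + H - 1) / (d * P) : ℕ) : ℝ) * (5 * H * X *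
        ∑ p₁ ∈ Q, ∑ p₂ ∈ Q,
          Vinogradov.geomBound ((((H - 1) / (d * P) : ℕ) : ℝ) + 1) (((p₁ : ℝ) - p₂) * α))) := by
  classical
  set M : ℕ := (X + H - 1) / (d * P) with hM
  set U : ℝ := (((H - 1) / (d * P) : ℕ) : ℝ) + 1 with hU
  have hU0 : 0 ≤ U := by positivity
  have hdP : 0 < d * P := Nat.mul_pos hd hP
  -- windows sit inside `T = [1, M]`
  have hWT : ∀ k ∈ Icc 1 X, ∀ p ∈ Q, windowDiv (d * p) H k ⊆ Icc 1 M := by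
    intro k hk p hp m hm
    rw [Finset.mem_Icc] at hk
    rw [mem_windowDiv hk.1] at hm
    rw [Finset.mem_Icc]
    obtain ⟨hPp, -⟩ := hQ p hp
    constructor
    · rcases Nat.eq_zero_or_pos m with rfl | h
      · rw [zero_mul] at hm; omega
      · exact h
    · rw [hM, Nat.le_div_iff_mul_le hdP]
      calc m * (d * P) ≤ m * (d * p) := Nat.mul_le_mul_left m (Nat.mul_le_mul_left d hPp)
        _ ≤ k + H - 1 := hm.2
        _ ≤ X + H - 1 := by omega
  -- the summands and the block sum `G`
  set e' : ℕ → ℕ → ℂ := fun m p => w p * (𝐞 (((m * p : ℕ) : ℝ) * α) : ℂ) with he'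
  have he'le : ∀ m p, ‖e' m p‖ ≤ 1 := by
    intro m p
    simp only [he', norm_mul, norm_fourierChar, mul_one]
    exact hw p
  set G : ℕ → ℂ := fun k => ∑ p ∈ Q, ∑ m ∈ windowDiv (d * p) H k,
      c m * w p * (𝐞 (((m * p : ℕ) : ℝ) * α) : ℂ) with hG
  have hGT : ∀ k ∈ Icc 1 X, G k = ∑ p ∈ Q, ∑ m ∈ Icc 1 M,
      if m ∈ windowDiv (d * p) H k then c m * e' m p else 0 := by
    intro k hk
    simp only [hG]
    refine Finset.sum_congr rfl fun p hp => ?_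
    rw [← Finset.sum_filter, Finset.filter_mem_eq_inter,
      Finset.inter_eq_right.mpr (hWT k hk p hp)]
    refine Finset.sum_congr rfl fun m _ => ?_
    simp only [he']
    ring
  -- duality weights
  set θ : ℕ → ℂ := fun k => (starRingEnd ℂ) (G k) / (‖G k‖ : ℂ) with hθ
  have hθle : ∀ k, ‖θ k‖ ≤ 1 := by
    intro k
    simp only [hθ, norm_div, Complex.norm_conj, Complex.norm_real, Real.norm_eq_abs, abs_norm]
    by_cases h : ‖G k‖ = 0
    · rw [h, div_zero]; exact zero_le_one
    · rw [div_self h]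
  have hθG : ∀ k, θ k * G k = (‖G k‖ : ℂ) := by
    intro k
    simp only [hθ]
    rw [div_mul_eq_mul_div, Complex.conj_mul', sq, mul_self_div_self]
  -- Step 1: `∑ |G k| = ∑_m c(m) B(m)`
  set B : ℕ → ℂ := fun m => ∑ k ∈ Icc 1 X, ∑ p ∈ Q,
      θ k * (if m ∈ windowDiv (d * p) H k then e' m p else 0) with hB
  have hsumG : (((∑ k ∈ Icc 1 X, ‖G k‖ : ℝ)) : ℂ) = ∑ m ∈ Icc 1 M, c m * B m := by
    push_cast
    simp_rw [← hθG]
    calc ∑ k ∈ Icc 1 X, θ k * G k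
        = ∑ k ∈ Icc 1 X, θ k * ∑ p ∈ Q, ∑ m ∈ Icc 1 M,
            (if m ∈ windowDiv (d * p) H k then c m * e' m p else 0) := by
          refine Finset.sum_congr rfl fun k hk => ?_
          rw [hGT k hk]
      _ = ∑ k ∈ Icc 1 X, ∑ p ∈ Q, ∑ m ∈ Icc 1 M,
            θ k * (if m ∈ windowDiv (d * p) H k then c m * e' m p else 0) := by
          simp_rw [Finset.mul_sum]
      _ = ∑ k ∈ Icc 1 X, ∑ p ∈ Q, ∑ m ∈ Icc 1 M,
            c m * (θ k * (if m ∈ windowDiv (d * p) H k then e' m p else 0)) := by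
          refine Finset.sum_congr rfl fun k _ => Finset.sum_congr rfl fun p _ =>
            Finset.sum_congr rfl fun m _ => ?_
          split_ifs <;> ring
      _ = ∑ k ∈ Icc 1 X, ∑ m ∈ Icc 1 M, ∑ p ∈ Q,
            c m * (θ k * (if m ∈ windowDiv (d * p) H k then e' m p else 0)) :=
          Finset.sum_congr rfl fun k _ => Finset.sum_comm
      _ = ∑ m ∈ Icc 1 M, ∑ k ∈ Icc 1 X, ∑ p ∈ Q,
            c m * (θ k * (if m ∈ windowDiv (d * p) H k then e' m p else 0)) :=
          Finset.sum_comm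
      _ = ∑ m ∈ Icc 1 M, c m * B m := by
          simp only [hB, Finset.mul_sum]
  -- Step 2: `∑ |G k| ≤ ∑_m |B m|`
  have hstep2 : ∑ k ∈ Icc 1 X, ‖G k‖ ≤ ∑ m ∈ Icc 1 M, ‖B m‖ := by
    have h1 : (∑ k ∈ Icc 1 X, ‖G k‖ : ℝ) = ‖(((∑ k ∈ Icc 1 X, ‖G k‖ : ℝ)) : ℂ)‖ :=
      (Complex.norm_of_nonneg (Finset.sum_nonneg fun k _ => norm_nonneg _)).symm
    rw [h1, hsumG]
    refine (norm_sum_le _ _).trans (Finset.sum_le_sum fun m _ => ?_)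
    rw [norm_mul]
    calc ‖c m‖ * ‖B m‖ ≤ 1 * ‖B m‖ := mul_le_mul_of_nonneg_right (hc m) (norm_nonneg _)
      _ = ‖B m‖ := one_mul _
  -- Step 3: Cauchy–Schwarz
  have hstep3 : ∑ m ∈ Icc 1 M, ‖B m‖ ≤ Real.sqrt (M * ∑ m ∈ Icc 1 M, ‖B m‖ ^ 2) := by
    have := sum_norm_le_sqrt_card_mul (Icc 1 M) B
    rwa [Nat.card_Icc, Nat.add_sub_cancel] at this
  -- Step 4: expansion over the index set `[1, X] × Q`
  set t : ℕ × ℕ → ℕ → ℂ := fun i m =>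
      θ i.1 * (if m ∈ windowDiv (d * i.2) H i.1 then e' m i.2 else 0) with ht
  have hBt : ∀ m, B m = ∑ i ∈ Icc 1 X ×ˢ Q, t i m := by
    intro m
    rw [hB, Finset.sum_product]
  have hstep4 : ∑ m ∈ Icc 1 M, ‖B m‖ ^ 2 ≤
      ∑ i ∈ Icc 1 X ×ˢ Q, ∑ j ∈ Icc 1 X ×ˢ Q,
        ‖∑ m ∈ Icc 1 M, t i m * (starRingEnd ℂ) (t j m)‖ := by
    simp_rw [hBt]
    exact sum_norm_sq_sum_le _ _ _
  -- Step 5: each pair `(i, j)` is a geometric sum over the intersection of two windows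
  have hstep5 : ∀ i ∈ Icc 1 X ×ˢ Q, ∀ j ∈ Icc 1 X ×ˢ Q,
      ‖∑ m ∈ Icc 1 M, t i m * (starRingEnd ℂ) (t j m)‖ ≤
        if (windowDiv (d * i.2) H i.1 ∩ windowDiv (d * j.2) H j.1).Nonempty then
          Vinogradov.geomBound U (((i.2 : ℝ) - j.2) * α) else 0 := by
    rintro ⟨k₁, p₁⟩ hi ⟨k₂, p₂⟩ hj
    rw [Finset.mem_product] at hi hj
    obtain ⟨hk₁, hp₁⟩ := hi
    obtain ⟨hk₂, hp₂⟩ := hj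
    simp only at hk₁ hp₁ hk₂ hp₂ ⊢
    have hk₁1 : 1 ≤ k₁ := (Finset.mem_Icc.mp hk₁).1
    have hk₂1 : 1 ≤ k₂ := (Finset.mem_Icc.mp hk₂).1
    have hp₁1 : 1 ≤ p₁ := hP.trans (hQ p₁ hp₁).1
    have hp₂1 : 1 ≤ p₂ := hP.trans (hQ p₂ hp₂).1
    have hdp₁ : 1 ≤ d * p₁ := Nat.mul_pos hd hp₁1
    have hdp₂ : 1 ≤ d * p₂ := Nat.mul_pos hd hp₂1
    -- the pointwise identity
    set K : ℂ := θ k₁ * (starRingEnd ℂ) (θ k₂) * (w p₁ * (starRingEnd ℂ) (w p₂)) with hK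
    have hKle : ‖K‖ ≤ 1 := by
      simp only [hK, norm_mul, Complex.norm_conj]
      calc ‖θ k₁‖ * ‖θ k₂‖ * (‖w p₁‖ * ‖w p₂‖) ≤ 1 * 1 * (1 * 1) :=
            mul_le_mul (mul_le_mul (hθle k₁) (hθle k₂) (norm_nonneg _) zero_le_one)
              (mul_le_mul (hw p₁) (hw p₂) (norm_nonneg _) zero_le_one)
              (mul_nonneg (norm_nonneg _) (norm_nonneg _)) (by norm_num)
        _ = 1 := by norm_num
    have hpt : ∀ m, t (k₁, p₁) m * (starRingEnd ℂ) (t (k₂, p₂) m) =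
        K * (if m ∈ windowDiv (d * p₁) H k₁ ∩ windowDiv (d * p₂) H k₂ then
          (𝐞 ((m : ℝ) * (((p₁ : ℝ) - p₂) * α)) : ℂ) else 0) := by
      intro m
      have hee : (𝐞 (((m * p₁ : ℕ) : ℝ) * α) : ℂ) *
          (starRingEnd ℂ) (𝐞 (((m * p₂ : ℕ) : ℝ) * α) : ℂ) =
          𝐞 ((m : ℝ) * (((p₁ : ℝ) - p₂) * α)) := by
        rw [fourierChar_mul_conj]
        congr 1
        push_cast
        ring
      simp only [ht, he', Finset.mem_inter]
      by_cases h1 : m ∈ windowDiv (d * p₁) H k₁ <;>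
        by_cases h2 : m ∈ windowDiv (d * p₂) H k₂ <;>
        simp only [h1, h2, if_true, if_false, and_true, and_false, and_self, mul_zero, map_zero,
          zero_mul, map_mul]
      rw [← hee, hK]
      ring
    rw [Finset.sum_congr rfl (fun m _ => hpt m), ← Finset.mul_sum, ← Finset.sum_filter, norm_mul,
      Finset.filter_mem_eq_inter, Finset.inter_eq_right.mpr
        ((Finset.inter_subset_left).trans (hWT k₁ hk₁ p₁ hp₁))]
    split_ifs with hne
    · have hgeom : ‖∑ m ∈ windowDiv (d * p₁) H k₁ ∩ windowDiv (d * p₂) H k₂,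
          (𝐞 ((m : ℝ) * (((p₁ : ℝ) - p₂) * α)) : ℂ)‖ ≤
          Vinogradov.geomBound U (((p₁ : ℝ) - p₂) * α) := by
        have hcard := card_windowDiv_le (H := H) hk₁1 hdp₁
        rw [Literature.NumberTheory.Sieve.Lichtman2020.windowDiv_eq_Icc hk₁1 hdp₁, Nat.card_Icc] at hcard
        rw [Literature.NumberTheory.Sieve.Lichtman2020.windowDiv_eq_Icc hk₁1 hdp₁, Literature.NumberTheory.Sieve.Lichtman2020.windowDiv_eq_Icc hk₂1 hdp₂, Icc_inter_Icc_nat]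
        apply norm_sum_Icc_fourierChar_le_geomBound'
        · exact le_max_of_le_left (one_le_div_windowDiv hk₁1 hdp₁)
        · rw [hU]
          have hdiv : (H - 1) / (d * p₁) ≤ (H - 1) / (d * P) :=
            Nat.div_le_div_left (Nat.mul_le_mul_left d (hQ p₁ hp₁).1) hdP
          have hmin : min ((k₁ + H - 1) / (d * p₁)) ((k₂ + H - 1) / (d * p₂)) ≤
              (k₁ + H - 1) / (d * p₁) := min_le_left _ _
          have hmax : (k₁ + d * p₁ - 1) / (d * p₁) ≤
              max ((k₁ + d * p₁ - 1) / (d * p₁)) ((k₂ + d * p₂ - 1) / (d * p₂)) := le_max_left _ _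
          have h3 : min ((k₁ + H - 1) / (d * p₁)) ((k₂ + H - 1) / (d * p₂)) + 1 -
              max ((k₁ + d * p₁ - 1) / (d * p₁)) ((k₂ + d * p₂ - 1) / (d * p₂)) ≤
              (H - 1) / (d * P) + 1 := by omega
          exact_mod_cast h3
      calc ‖K‖ * ‖∑ m ∈ windowDiv (d * p₁) H k₁ ∩ windowDiv (d * p₂) H k₂,
            (𝐞 ((m : ℝ) * (((p₁ : ℝ) - p₂) * α)) : ℂ)‖
          ≤ 1 * Vinogradov.geomBound U (((p₁ : ℝ) - p₂) * α) :=
            mul_le_mul hKle hgeom (norm_nonneg _) zero_le_one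
        _ = _ := one_mul _
    · rw [Finset.not_nonempty_iff_eq_empty.mp hne, Finset.sum_empty, norm_zero, mul_zero]
  -- Step 6: reorganise the sum over pairs and count
  have hstep6 : ∑ i ∈ Icc 1 X ×ˢ Q, ∑ j ∈ Icc 1 X ×ˢ Q,
      (if (windowDiv (d * i.2) H i.1 ∩ windowDiv (d * j.2) H j.1).Nonempty then
          Vinogradov.geomBound U (((i.2 : ℝ) - j.2) * α) else 0) ≤
      5 * H * X * ∑ p₁ ∈ Q, ∑ p₂ ∈ Q, Vinogradov.geomBound U (((p₁ : ℝ) - p₂) * α) := by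
    rw [Finset.mul_sum, Finset.sum_product_right]
    refine Finset.sum_le_sum fun p₁ hp₁ => ?_
    rw [Finset.mul_sum]
    simp_rw [Finset.sum_product_right]
    rw [Finset.sum_comm]
    refine Finset.sum_le_sum fun p₂ hp₂ => ?_
    have hg0 : 0 ≤ Vinogradov.geomBound U (((p₁ : ℝ) - p₂) * α) :=
      Vinogradov.geomBound_nonneg hU0 _
    have hp21 : p₂ ≤ 2 * p₁ := by
      have := (hQ p₂ hp₂).2
      have := (hQ p₁ hp₁).1
      omega
    calc ∑ k₁ ∈ Icc 1 X, ∑ k₂ ∈ Icc 1 X,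
          (if (windowDiv (d * p₁) H k₁ ∩ windowDiv (d * p₂) H k₂).Nonempty then
            Vinogradov.geomBound U (((p₁ : ℝ) - p₂) * α) else 0)
        = ∑ k₁ ∈ Icc 1 X, (#((Icc 1 X).filter fun k₂ =>
            (windowDiv (d * p₁) H k₁ ∩ windowDiv (d * p₂) H k₂).Nonempty) : ℝ) *
            Vinogradov.geomBound U (((p₁ : ℝ) - p₂) * α) := by
          refine Finset.sum_congr rfl fun k₁ _ => ?_
          rw [Finset.sum_ite, Finset.sum_const_zero, add_zero, Finset.sum_const, nsmul_eq_mul]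
      _ ≤ ∑ k₁ ∈ Icc 1 X, (5 * H : ℝ) * Vinogradov.geomBound U (((p₁ : ℝ) - p₂) * α) := by
          refine Finset.sum_le_sum fun k₁ hk₁ => mul_le_mul_of_nonneg_right ?_ hg0
          exact_mod_cast card_filter_windowDiv_inter_nonempty_le (X := X) (d := d) (H := H)
            (Finset.mem_Icc.mp hk₁).1 hp21
      _ = 5 * H * X * Vinogradov.geomBound U (((p₁ : ℝ) - p₂) * α) := by
          rw [Finset.sum_const, Nat.card_Icc, Nat.add_sub_cancel, nsmul_eq_mul]
          ring
  -- assembly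
  have hM0 : (0 : ℝ) ≤ M := Nat.cast_nonneg M
  calc ∑ k ∈ Icc 1 X, ‖G k‖ ≤ ∑ m ∈ Icc 1 M, ‖B m‖ := hstep2
    _ ≤ Real.sqrt (M * ∑ m ∈ Icc 1 M, ‖B m‖ ^ 2) := hstep3
    _ ≤ Real.sqrt (M * (5 * H * X *
          ∑ p₁ ∈ Q, ∑ p₂ ∈ Q, Vinogradov.geomBound U (((p₁ : ℝ) - p₂) * α))) := by
        apply Real.sqrt_le_sqrt
        apply mul_le_mul_of_nonneg_left _ hM0
        exact hstep4.trans ((Finset.sum_le_sum fun i hi => Finset.sum_le_sum fun j hj =>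
          hstep5 i hi j hj).trans hstep6)

/-! ### From the pair sum to Vinogradov's lemma -/

/-- `∑_{p₁, p₂ ∈ Q} min(U, 1/(2‖(p₁-p₂)α‖)) ≤ #Q · U + 2 #Q ∑_{1 ≤ n ≤ 2P} min(U, 1/(2‖nα‖))` for
`Q ⊆ [P, 2P)` (diagonal + the differences `n = ±(p₁ - p₂) ∈ [1, 2P)`, each attained at most once for
fixed `p₁`; the paper inserts here the prime-pair sieve bound, which Theorem 2.2 does not need).
[cite: Lichtman2020, §3.1, (3.6)] -/
theorem sum_sum_geomBound_sub_le {P : ℕ} (Q : Finset ℕ) (hQ : ∀ p ∈ Q, P ≤ p ∧ p < 2 * P)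
    {U : ℝ} (hU : 0 ≤ U) (α : ℝ) :
    ∑ p₁ ∈ Q, ∑ p₂ ∈ Q, Vinogradov.geomBound U (((p₁ : ℝ) - p₂) * α) ≤
      #Q * U + 2 * #Q * ∑ n ∈ Icc 1 (2 * P), Vinogradov.geomBound U ((n : ℝ) * α) := by
  classical
  set Sv : ℝ := ∑ n ∈ Icc 1 (2 * P), Vinogradov.geomBound U ((n : ℝ) * α) with hSv
  have hg0 : ∀ x, 0 ≤ Vinogradov.geomBound U x := fun x => Vinogradov.geomBound_nonneg hU x
  have hSv0 : 0 ≤ Sv := Finset.sum_nonneg fun n _ => hg0 _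
  have key : ∀ p₁ ∈ Q, ∑ p₂ ∈ Q, Vinogradov.geomBound U (((p₁ : ℝ) - p₂) * α) ≤ U + 2 * Sv := by
    intro p₁ hp₁
    have hp₁2 := (hQ p₁ hp₁).2
    rw [← Finset.sum_filter_add_sum_filter_not Q (· = p₁),
      ← Finset.sum_filter_add_sum_filter_not (Q.filter (¬ · = p₁)) (· < p₁)]
    -- diagonal
    have hdiag : ∑ p₂ ∈ Q.filter (· = p₁), Vinogradov.geomBound U (((p₁ : ℝ) - p₂) * α) ≤ U := by
      calc ∑ p₂ ∈ Q.filter (· = p₁), Vinogradov.geomBound U (((p₁ : ℝ) - p₂) * α)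
          ≤ ∑ p₂ ∈ {p₁}, Vinogradov.geomBound U (((p₁ : ℝ) - p₂) * α) := by
            apply Finset.sum_le_sum_of_subset_of_nonneg
            · intro x hx
              rw [Finset.mem_filter] at hx
              rw [Finset.mem_singleton]
              exact hx.2
            · intro x _ _; exact hg0 _
        _ = U := by rw [Finset.sum_singleton, sub_self, zero_mul, Vinogradov.geomBound_zero]
    -- p₂ < p₁
    have hlt : ∑ p₂ ∈ (Q.filter (¬ · = p₁)).filter (· < p₁),
        Vinogradov.geomBound U (((p₁ : ℝ) - p₂) * α) ≤ Sv := by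
      set F := (Q.filter (¬ · = p₁)).filter (· < p₁) with hF
      have hFmem : ∀ p₂ ∈ F, p₂ < p₁ := fun p₂ h => (Finset.mem_filter.mp h).2
      calc ∑ p₂ ∈ F, Vinogradov.geomBound U (((p₁ : ℝ) - p₂) * α)
          = ∑ p₂ ∈ F, Vinogradov.geomBound U (((p₁ - p₂ : ℕ) : ℝ) * α) := by
            refine Finset.sum_congr rfl fun p₂ h => ?_
            rw [Nat.cast_sub (hFmem p₂ h).le]
        _ = ∑ n ∈ F.image (fun p₂ => p₁ - p₂), Vinogradov.geomBound U ((n : ℝ) * α) := by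
            rw [Finset.sum_image]
            intro x hx y hy hxy
            have := hFmem x hx; have := hFmem y hy
            simp only at hxy
            omega
        _ ≤ Sv := by
            apply Finset.sum_le_sum_of_subset_of_nonneg
            · intro n hn
              rw [Finset.mem_image] at hn
              obtain ⟨p₂, hp₂, rfl⟩ := hn
              have := hFmem p₂ hp₂
              rw [Finset.mem_Icc]; omega
            · intro x _ _; exact hg0 _
    -- p₂ > p₁
    have hgt : ∑ p₂ ∈ (Q.filter (¬ · = p₁)).filter (¬ · < p₁),
        Vinogradov.geomBound U (((p₁ : ℝ) - p₂) * α) ≤ Sv := by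
      set F := (Q.filter (¬ · = p₁)).filter (¬ · < p₁) with hF
      have hFmem : ∀ p₂ ∈ F, p₁ < p₂ ∧ p₂ < 2 * P := by
        intro p₂ h
        rw [hF, Finset.mem_filter, Finset.mem_filter] at h
        exact ⟨by omega, (hQ p₂ h.1.1).2⟩
      calc ∑ p₂ ∈ F, Vinogradov.geomBound U (((p₁ : ℝ) - p₂) * α)
          = ∑ p₂ ∈ F, Vinogradov.geomBound U (((p₂ - p₁ : ℕ) : ℝ) * α) := by
            refine Finset.sum_congr rfl fun p₂ h => ?_
            rw [Nat.cast_sub (hFmem p₂ h).1.le, ← Vinogradov.geomBound_neg]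
            congr 1
            ring
        _ = ∑ n ∈ F.image (fun p₂ => p₂ - p₁), Vinogradov.geomBound U ((n : ℝ) * α) := by
            rw [Finset.sum_image]
            intro x hx y hy hxy
            have := (hFmem x hx).1; have := (hFmem y hy).1
            simp only at hxy
            omega
        _ ≤ Sv := by
            apply Finset.sum_le_sum_of_subset_of_nonneg
            · intro n hn
              rw [Finset.mem_image] at hn
              obtain ⟨p₂, hp₂, rfl⟩ := hn
              have := hFmem p₂ hp₂
              rw [Finset.mem_Icc]; omega
            · intro x _ _; exact hg0 _
    linarith
  calc ∑ p₁ ∈ Q, ∑ p₂ ∈ Q, Vinogradov.geomBound U (((p₁ : ℝ) - p₂) * α)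
      ≤ ∑ p₁ ∈ Q, (U + 2 * Sv) := Finset.sum_le_sum key
    _ = #Q * U + 2 * #Q * Sv := by rw [Finset.sum_const, nsmul_eq_mul]; ring

/-- **Lemma 3.3 on the minor arcs for the constant majorant**: for `α ∈ 𝔪(W, Q₁)`, `P ≥ 1`, `U ≥ 0`,
`∑_{1 ≤ n ≤ 2P} min(U, 1/(2‖nα‖)) ≤ 4 (2PU/W + 2P + Q₁)(1 + log(2PQ₁))`, from
`min(U, ·) ≤ min(2PU/n, ·)` for `n ≤ 2P` and `sum_geomBound_le_of_mem_minorArcs`.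
[cite: Lichtman2020, Lemma 3.3] -/
theorem sum_geomBound_const_le_of_mem_minorArcs {W Q₁ α U : ℝ} (hW : 0 < W) (hQ₁ : 1 ≤ Q₁)
    (hα : α ∈ lichtmanMinorArcs W Q₁) (hU : 0 ≤ U) {P : ℕ} (hP : 1 ≤ P) :
    ∑ n ∈ Icc 1 (2 * P), Vinogradov.geomBound U ((n : ℝ) * α) ≤
      4 * (2 * P * U / W + 2 * P + Q₁) * (1 + Real.log (Q₁ * (2 * P))) := by
  have h1 : ∀ n ∈ Icc 1 (2 * P), Vinogradov.geomBound U ((n : ℝ) * α) ≤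
      Vinogradov.geomBound ((2 * P * U) / n) (α * n) := by
    intro n hn
    rw [mul_comm (n : ℝ) α]
    apply Vinogradov.geomBound_mono
    have hn' := Finset.mem_Icc.mp hn
    have hn0 : (0 : ℝ) < n := by exact_mod_cast hn'.1
    have hn2 : (n : ℝ) ≤ 2 * P := by exact_mod_cast hn'.2
    rw [le_div_iff₀ hn0]
    nlinarith
  refine (Finset.sum_le_sum h1).trans ?_
  have h2 := sum_geomBound_le_of_mem_minorArcs hW hQ₁ hα (N := 2 * P * U) (by positivity)
    (U := 2 * P) (by omega)
  push_cast at h2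
  exact h2

/-! ### The Ramaré decomposition of the window sum -/

/-- **(3.2)–(3.3) of Lichtman 2020 in discrete form.**  Let `Ps` be a finite set of primes such that
every `n ∈ S` is divisible by one of them, and `S(mp) ↔ S₂(m)` for `p ∈ Ps`, `m ≥ 1` (in the paper:
`Ps` = primes of `[P₁, Q₁]`, `S = S_d`, `S₂ = S^{(1)}_d`, using `Q₁ < P₂`).  With
`ω(n) = #{q ∈ Ps : q ∣ n}` and `c(m) = 𝟙_{S₂}(m) g(m)/(ω(m) + 1)`, the window sum
`∑_{n ∈ windowDiv d H k ∩ S} g(n) e(nα)` differs from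
`∑_{p ∈ Ps} ∑_{m ∈ windowDiv (dp) H k} c(m) g(p) e(mpα)` by at most
`2 ∑_{p ∈ Ps} #windowDiv (dp²) H k` (the terms with `p ∣ m`; Ramaré's identity
`𝟙_S(n) = ∑_{p ∣ n} 1/ω(n)` and `ω(mp) = ω(m) + 1` for `p ∤ m`).
[cite: Lichtman2020, §3.1, (3.2)–(3.3)] -/
theorem norm_twistedSum_sub_ramare_le {d H k : ℕ} (hk : 1 ≤ k) (Ps : Finset ℕ)
    (hPs : ∀ p ∈ Ps, p.Prime) (S S₂ : ℕ → Prop) [DecidablePred S] [DecidablePred S₂]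
    (hS : ∀ n, S n → n ≠ 0 ∧ ∃ p ∈ Ps, p ∣ n)
    (hS₂ : ∀ p ∈ Ps, ∀ m, m ≠ 0 → (S (m * p) ↔ S₂ m))
    (g : ℕ → ℂ) (hgmul : ∀ m n, g (m * n) = g m * g n) (hg : ∀ n, ‖g n‖ ≤ 1) (α : ℝ)
    (c : ℕ → ℂ) (hc : ∀ m, c m = if S₂ m then g m / ((#(Ps.filter (· ∣ m)) : ℂ) + 1) else 0) :
    ‖twistedSum g ((windowDiv d H k).filter S) α -
        ∑ p ∈ Ps, ∑ m ∈ windowDiv (d * p) H k, c m * g p * (𝐞 (((m * p : ℕ) : ℝ) * α) : ℂ)‖ ≤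
      2 * ∑ p ∈ Ps, (#(windowDiv (d * p * p) H k) : ℝ) := by
  classical
  simp only [hc]
  -- the Ramaré expansion of the window sum
  set F : ℕ → ℂ := fun n => if S n then
      (1 / ((#(Ps.filter (· ∣ n)) : ℂ))) * (g n * (𝐞 ((n : ℝ) * α) : ℂ)) else 0 with hF
  have hexp : twistedSum g ((windowDiv d H k).filter S) α =
      ∑ p ∈ Ps, ∑ m ∈ windowDiv (d * p) H k, F (m * p) := by
    unfold twistedSum
    calc ∑ n ∈ (windowDiv d H k).filter S, g n * (𝐞 ((n : ℝ) * α) : ℂ)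
        = ∑ n ∈ (windowDiv d H k).filter S, ∑ p ∈ Ps.filter (· ∣ n),
            (1 / ((#(Ps.filter (· ∣ n)) : ℂ))) * (g n * (𝐞 ((n : ℝ) * α) : ℂ)) := by
          refine Finset.sum_congr rfl fun n hn => ?_
          rw [Finset.mem_filter] at hn
          obtain ⟨-, p, hp, hpn⟩ := hS n hn.2
          have hω0 : ((#(Ps.filter (· ∣ n)) : ℂ)) ≠ 0 := by
            rw [Nat.cast_ne_zero]
            exact Finset.card_ne_zero.mpr ⟨p, Finset.mem_filter.mpr ⟨hp, hpn⟩⟩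
          rw [Finset.sum_const, nsmul_eq_mul, ← mul_assoc, mul_one_div_cancel hω0, one_mul]
      _ = ∑ n ∈ windowDiv d H k, ∑ p ∈ Ps, if S n ∧ p ∣ n then
            (1 / ((#(Ps.filter (· ∣ n)) : ℂ))) * (g n * (𝐞 ((n : ℝ) * α) : ℂ)) else 0 := by
          rw [Finset.sum_filter]
          refine Finset.sum_congr rfl fun n _ => ?_
          rw [Finset.sum_filter]
          by_cases h : S n
          · simp only [h, if_true, true_and]
          · simp only [h, if_false, false_and]
            rw [Finset.sum_const_zero]
      _ = ∑ p ∈ Ps, ∑ n ∈ windowDiv d H k, if S n ∧ p ∣ n then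
            (1 / ((#(Ps.filter (· ∣ n)) : ℂ))) * (g n * (𝐞 ((n : ℝ) * α) : ℂ)) else 0 :=
          Finset.sum_comm
      _ = ∑ p ∈ Ps, ∑ n ∈ (windowDiv d H k).filter (p ∣ ·), F n := by
          refine Finset.sum_congr rfl fun p _ => ?_
          rw [Finset.sum_filter]
          refine Finset.sum_congr rfl fun n _ => ?_
          simp only [hF]
          by_cases h1 : p ∣ n
          · by_cases h2 : S n
            · rw [if_pos ⟨h2, h1⟩, if_pos h1, if_pos h2]
            · rw [if_neg (fun h => h2 h.1), if_pos h1, if_neg h2]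
          · rw [if_neg (fun h => h1 h.2), if_neg h1]
      _ = ∑ p ∈ Ps, ∑ m ∈ windowDiv (d * p) H k, F (m * p) := by
          refine Finset.sum_congr rfl fun p hp => ?_
          exact sum_windowDiv_filter_dvd hk (hPs p hp).pos F
  rw [hexp, ← Finset.sum_sub_distrib]
  simp_rw [← Finset.sum_sub_distrib]
  -- termwise: the difference vanishes unless `p ∣ m`, and is at most `2`
  have hterm : ∀ p ∈ Ps, ∀ m ∈ windowDiv (d * p) H k,
      ‖F (m * p) - (if S₂ m then g m / ((#(Ps.filter (· ∣ m)) : ℂ) + 1) else 0) * g p *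
          (𝐞 (((m * p : ℕ) : ℝ) * α) : ℂ)‖ ≤ if p ∣ m then 2 else 0 := by
    intro p hp m hm
    have hpp := hPs p hp
    have hm0 : m ≠ 0 := by
      intro h0
      rw [h0, mem_windowDiv hk, zero_mul] at hm
      omega
    have h1 : ‖F (m * p)‖ ≤ 1 := by
      simp only [hF]
      by_cases hS1 : S (m * p)
      · rw [if_pos hS1, norm_mul, norm_mul, norm_fourierChar, mul_one]
        have hω1 : ‖(1 / ((#(Ps.filter (· ∣ m * p)) : ℂ)))‖ ≤ 1 := by
          rw [norm_div, norm_one, Complex.norm_natCast]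
          rcases Nat.eq_zero_or_pos (#(Ps.filter (· ∣ m * p))) with h0 | h0
          · rw [h0, Nat.cast_zero, div_zero]; exact zero_le_one
          · rw [div_le_one (by exact_mod_cast h0)]; exact_mod_cast h0
        calc ‖(1 / ((#(Ps.filter (· ∣ m * p)) : ℂ)))‖ * ‖g (m * p)‖ ≤ 1 * 1 :=
              mul_le_mul hω1 (hg _) (norm_nonneg _) zero_le_one
          _ = 1 := one_mul _
      · rw [if_neg hS1, norm_zero]; exact zero_le_one
    have h2 : ‖(if S₂ m then g m / ((#(Ps.filter (· ∣ m)) : ℂ) + 1) else 0) * g p *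
        (𝐞 (((m * p : ℕ) : ℝ) * α) : ℂ)‖ ≤ 1 := by
      rw [norm_mul, norm_mul, norm_fourierChar, mul_one]
      have h3 : ‖(if S₂ m then g m / ((#(Ps.filter (· ∣ m)) : ℂ) + 1) else 0)‖ ≤ 1 := by
        by_cases hS2 : S₂ m
        · rw [if_pos hS2, norm_div]
          have h4 : (1 : ℝ) ≤ ‖((#(Ps.filter (· ∣ m)) : ℂ) + 1)‖ := by
            have h5 : ((#(Ps.filter (· ∣ m)) : ℂ) + 1) = (((#(Ps.filter (· ∣ m)) + 1 : ℕ)) : ℂ) := by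
              push_cast; ring
            rw [h5, Complex.norm_natCast]
            exact_mod_cast Nat.le_add_left 1 _
          calc ‖g m‖ / ‖((#(Ps.filter (· ∣ m)) : ℂ) + 1)‖ ≤ ‖g m‖ / 1 :=
                div_le_div_of_nonneg_left (norm_nonneg _) one_pos h4
            _ ≤ 1 := by rw [div_one]; exact hg m
        · rw [if_neg hS2, norm_zero]; exact zero_le_one
      calc ‖(if S₂ m then g m / ((#(Ps.filter (· ∣ m)) : ℂ) + 1) else 0)‖ * ‖g p‖
          ≤ (1 : ℝ) * 1 := mul_le_mul h3 (hg p) (norm_nonneg _) zero_le_one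
        _ = 1 := one_mul _
    by_cases hpm : p ∣ m
    · rw [if_pos hpm]
      refine (norm_sub_le _ _).trans ?_
      linarith
    · rw [if_neg hpm]
      have hω' : #(Ps.filter (· ∣ m * p)) = #(Ps.filter (· ∣ m)) + 1 := by
        have h := card_filter_dvd_eq_card_filter_dvd_div Ps hPs (n := m * p)
          (Nat.mul_ne_zero hm0 hpp.ne_zero) hp (dvd_mul_left p m)
        rw [Nat.mul_div_cancel _ hpp.pos, if_neg hpm] at h
        exact h
      have hSiff := hS₂ p hp m hm0
      have hzero : F (m * p) - (if S₂ m then g m / ((#(Ps.filter (· ∣ m)) : ℂ) + 1) else 0) * g p *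
          (𝐞 (((m * p : ℕ) : ℝ) * α) : ℂ) = 0 := by
        simp only [hF]
        by_cases hS2 : S₂ m
        · rw [if_pos (hSiff.mpr hS2), if_pos hS2, hω', hgmul]
          push_cast
          ring
        · rw [if_neg (fun h => hS2 (hSiff.mp h)), if_neg hS2]
          ring
      rw [hzero, norm_zero]
  calc ‖∑ p ∈ Ps, ∑ m ∈ windowDiv (d * p) H k, (F (m * p) -
          (if S₂ m then g m / ((#(Ps.filter (· ∣ m)) : ℂ) + 1) else 0) * g p *
            (𝐞 (((m * p : ℕ) : ℝ) * α) : ℂ))‖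
      ≤ ∑ p ∈ Ps, ∑ m ∈ windowDiv (d * p) H k, ‖F (m * p) -
          (if S₂ m then g m / ((#(Ps.filter (· ∣ m)) : ℂ) + 1) else 0) * g p *
            (𝐞 (((m * p : ℕ) : ℝ) * α) : ℂ)‖ :=
        (norm_sum_le _ _).trans (Finset.sum_le_sum fun p _ => norm_sum_le _ _)
    _ ≤ ∑ p ∈ Ps, ∑ m ∈ windowDiv (d * p) H k, (if p ∣ m then (2 : ℝ) else 0) :=
        Finset.sum_le_sum fun p hp => Finset.sum_le_sum fun m hm => hterm p hp m hm
    _ = 2 * ∑ p ∈ Ps, (#(windowDiv (d * p * p) H k) : ℝ) := by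
        rw [Finset.mul_sum]
        refine Finset.sum_congr rfl fun p hp => ?_
        rw [← Finset.sum_filter, Finset.sum_const, nsmul_eq_mul, mul_comm]
        congr 1
        have h := sum_windowDiv_filter_dvd (d := d * p) (H := H) hk (hPs p hp).pos
          (fun _ => (1 : ℂ))
        rw [Finset.sum_const, Finset.sum_const, nsmul_eq_mul, nsmul_eq_mul, mul_one, mul_one] at h
        exact_mod_cast h

/-! ### Numeric lemmas -/

/-- `∑_{j < n} 1/√(j+1) ≤ 2√n`. [folklore] -/
theorem sum_inv_sqrt_le (n : ℕ) :
    ∑ j ∈ range n, 1 / Real.sqrt ((j : ℝ) + 1) ≤ 2 * Real.sqrt n := by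
  induction n with
  | zero => simp
  | succ n ih =>
    rw [Finset.sum_range_succ]
    have h1 : 0 < Real.sqrt ((n : ℝ) + 1) := Real.sqrt_pos.mpr (by positivity)
    have h0 : 0 ≤ Real.sqrt (n : ℝ) := Real.sqrt_nonneg _
    have h2 : 1 / Real.sqrt ((n : ℝ) + 1) ≤ 2 * (Real.sqrt ((n : ℝ) + 1) - Real.sqrt n) := by
      rw [div_le_iff₀ h1]
      have h3 : Real.sqrt ((n : ℝ) + 1) * Real.sqrt ((n : ℝ) + 1) = n + 1 :=
        Real.mul_self_sqrt (by positivity)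
      have h4 : Real.sqrt (n : ℝ) * Real.sqrt (n : ℝ) = n := Real.mul_self_sqrt (by positivity)
      have h5 : Real.sqrt (n : ℝ) ≤ Real.sqrt ((n : ℝ) + 1) := Real.sqrt_le_sqrt (by linarith)
      nlinarith
    push_cast
    linarith

/-- `log 2 ≥ 2/3`. [folklore] -/
theorem two_thirds_le_log_two : (2 : ℝ) / 3 ≤ Real.log 2 := by
  have := Real.log_two_gt_d9; linarith

/-- The numeric heart of the block estimate: under the size relations of §3.1
(`2 ≤ W`, `1 ≤ d ≤ W`, `W³³/2 ≤ P ≤ Q₁ = H/W⁴`, `H ≤ X`), the quantity `M · 5HX · V` of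
`core_block_bound`, with `M ≤ (X+H)/(dP)`, `U ≤ H/(dP) + 1`, `#Q ≤ 12P/log(2P)` and
`V ≤ #Q·U + 2#Q·4(2PU/W + 2P + Q₁)L₁`, `L₁ ≤ Λ`, is at most `4920 H²X²Λ/(d²W log(2P))`. [folklore] -/
theorem block_numeric_bound {X H d W P Q₁ Λ M U cQ L₁ V : ℝ} (hW : 2 ≤ W) (hd : 1 ≤ d)
    (hdW : d ≤ W) (hP : W ^ 33 / 2 ≤ P) (hPQ : P ≤ Q₁) (hQ₁ : Q₁ = H / W ^ 4) (hHX : H ≤ X)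
    (hM0 : 0 ≤ M) (hM : M ≤ (X + H) / (d * P)) (hU0 : 0 ≤ U) (hU : U ≤ H / (d * P) + 1)
    (hcQ0 : 0 ≤ cQ) (hlog : 0 < Real.log (2 * P)) (hcQ : cQ ≤ 12 * P / Real.log (2 * P))
    (hL₁0 : 0 ≤ L₁) (hL₁ : L₁ ≤ Λ) (hΛ : 1 ≤ Λ)
    (hV : V ≤ cQ * U + 2 * cQ * (4 * (2 * P * U / W + 2 * P + Q₁) * L₁)) :
    M * (5 * H * X * V) ≤ 4920 * (H ^ 2 * X ^ 2 * Λ / (d ^ 2 * W * Real.log (2 * P))) := by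
  have hW0 : 0 < W := by linarith
  have hd0 : 0 < d := by linarith
  have hW2 : (2 : ℝ) ^ 2 ≤ W ^ 2 := pow_le_pow_left₀ (by norm_num) hW 2
  have hW32 : (2 : ℝ) ^ 32 ≤ W ^ 32 := pow_le_pow_left₀ (by norm_num) hW 32
  have hW35 : (2 : ℝ) ^ 35 ≤ W ^ 35 := pow_le_pow_left₀ (by norm_num) hW 35
  have hW20 : 0 < W ^ 2 := by positivity
  -- elementary size relations between the powers of `W`
  have hdW2 : d * W ≤ W ^ 2 := by
    calc d * W ≤ W * W := mul_le_mul_of_nonneg_right hdW hW0.le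
      _ = W ^ 2 := (sq W).symm
  have hP2W : 2 * W ≤ P := by
    have h1 : W * 4 ≤ W * W ^ 32 :=
      mul_le_mul_of_nonneg_left (by linarith [hW32, show (4 : ℝ) ≤ 2 ^ 32 by norm_num]) hW0.le
    have h2 : W ^ 33 = W * W ^ 32 := by ring
    linarith
  have hP0 : 0 < P := by linarith
  have hH : P * W ^ 4 ≤ H := by
    rw [hQ₁, le_div_iff₀ (by positivity)] at hPQ; exact hPQ
  have hW37 : 4 * W ^ 2 ≤ W ^ 37 := by
    have h1 : W ^ 2 * 4 ≤ W ^ 2 * W ^ 35 :=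
      mul_le_mul_of_nonneg_left (by linarith [hW35, show (4 : ℝ) ≤ 2 ^ 35 by norm_num]) hW20.le
    have h2 : W ^ 37 = W ^ 2 * W ^ 35 := by ring
    linarith
  have hH37 : W ^ 37 / 2 ≤ H := by
    have : W ^ 33 / 2 * W ^ 4 ≤ P * W ^ 4 := mul_le_mul_of_nonneg_right hP (by positivity)
    calc W ^ 37 / 2 = W ^ 33 / 2 * W ^ 4 := by ring
      _ ≤ H := this.trans hH
  have hH0 : 0 < H := by
    have : 0 < W ^ 37 := by positivity
    linarith
  have hX0 : 0 < X := by linarith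
  set R : ℝ := H / (d * W) with hR
  have hR0 : 0 < R := by positivity
  -- (1) `U ≤ R`
  have h1a : H / (d * P) ≤ R / 2 := by
    calc H / (d * P) ≤ H / (d * (2 * W)) :=
          div_le_div_of_nonneg_left hH0.le (by positivity) (mul_le_mul_of_nonneg_left hP2W hd0.le)
      _ = R / 2 := by rw [hR]; field_simp
  have h1b : 1 ≤ R / 2 := by
    have h2dW : 2 * (d * W) ≤ H := by linarith
    rw [hR, le_div_iff₀ (by norm_num), le_div_iff₀ (by positivity)]
    linarith
  have hUR : U ≤ R := by linarith
  -- (2) `2PU/W ≤ 3R`, (3) `2P ≤ R`, (4) `Q₁ ≤ R`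
  have hPU : P * U ≤ H / d + P := by
    calc P * U ≤ P * (H / (d * P) + 1) := mul_le_mul_of_nonneg_left hU hP0.le
      _ = H / d + P := by field_simp
  have h2P : 2 * P ≤ R := by
    rw [hR, le_div_iff₀ (by positivity)]
    have h3 : 2 * P * (d * W) ≤ 2 * P * W ^ 2 := mul_le_mul_of_nonneg_left hdW2 (by positivity)
    have h4 : W ^ 2 * 4 ≤ W ^ 2 * W ^ 2 := mul_le_mul_of_nonneg_left (by linarith) hW20.le
    have h5 : W ^ 4 = W ^ 2 * W ^ 2 := by ring
    have h6 : 2 * P * W ^ 2 ≤ P * W ^ 4 := by nlinarith [hP0.le]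
    linarith
  have h2a : 2 * P * U / W ≤ 3 * R := by
    have h5 : 2 * P * U / W ≤ 2 * (H / d + P) / W :=
      div_le_div_of_nonneg_right (by linarith) hW0.le
    have h6 : 2 * (H / d + P) / W = 2 * R + 2 * P / W := by rw [hR]; field_simp
    have h7 : 2 * P / W ≤ R := by
      calc 2 * P / W ≤ 2 * P / 1 := div_le_div_of_nonneg_left (by positivity) one_pos (by linarith)
        _ = 2 * P := div_one _
        _ ≤ R := h2P
    linarith
  have hQR : Q₁ ≤ R := by
    rw [hQ₁, hR]
    apply div_le_div_of_nonneg_left hH0.le (by positivity)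
    have h4 : W ^ 2 * 1 ≤ W ^ 2 * W ^ 2 := mul_le_mul_of_nonneg_left (by linarith) hW20.le
    have h5 : W ^ 4 = W ^ 2 * W ^ 2 := by ring
    linarith
  -- (5) `V ≤ 41 cQ R Λ ≤ 492 P R Λ / log(2P)`
  have hin : 4 * (2 * P * U / W + 2 * P + Q₁) * L₁ ≤ 20 * R * Λ := by
    have h8 : 2 * P * U / W + 2 * P + Q₁ ≤ 5 * R := by linarith
    have hQ0 : 0 ≤ Q₁ := by rw [hQ₁]; positivity
    have h9 : 0 ≤ 2 * P * U / W + 2 * P + Q₁ :=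
      add_nonneg (add_nonneg (by positivity) (by positivity)) hQ0
    calc 4 * (2 * P * U / W + 2 * P + Q₁) * L₁ ≤ 4 * (5 * R) * Λ :=
          mul_le_mul (by linarith) hL₁ hL₁0 (by positivity)
      _ = 20 * R * Λ := by ring
  have hV1 : V ≤ 41 * cQ * R * Λ := by
    have h10 : cQ * U ≤ cQ * R * Λ := by
      calc cQ * U ≤ cQ * R := mul_le_mul_of_nonneg_left hUR hcQ0
        _ = cQ * R * 1 := (mul_one _).symm
        _ ≤ cQ * R * Λ := mul_le_mul_of_nonneg_left hΛ (by positivity)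
    have h11 : 2 * cQ * (4 * (2 * P * U / W + 2 * P + Q₁) * L₁) ≤ 2 * cQ * (20 * R * Λ) :=
      mul_le_mul_of_nonneg_left hin (by positivity)
    linarith
  have hV2 : V ≤ 492 * (P * R * Λ / Real.log (2 * P)) := by
    calc V ≤ 41 * cQ * R * Λ := hV1
      _ = cQ * (41 * R * Λ) := by ring
      _ ≤ 12 * P / Real.log (2 * P) * (41 * R * Λ) :=
          mul_le_mul_of_nonneg_right hcQ (by positivity)
      _ = 492 * (P * R * Λ / Real.log (2 * P)) := by field_simp; ring
  -- (6) `M ≤ 2X/(dP)` and assembly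
  have hM2 : M ≤ 2 * X / (d * P) := by
    refine hM.trans (div_le_div_of_nonneg_right (by linarith) (by positivity))
  have hB0 : 0 ≤ 492 * (P * R * Λ / Real.log (2 * P)) := by positivity
  calc M * (5 * H * X * V) ≤ M * (5 * H * X * (492 * (P * R * Λ / Real.log (2 * P)))) := by
        apply mul_le_mul_of_nonneg_left _ hM0
        exact mul_le_mul_of_nonneg_left hV2 (by positivity)
    _ ≤ 2 * X / (d * P) * (5 * H * X * (492 * (P * R * Λ / Real.log (2 * P)))) :=
        mul_le_mul_of_nonneg_right hM2 (by positivity)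
    _ = 4920 * (H ^ 2 * X ^ 2 * Λ / (d ^ 2 * W * Real.log (2 * P))) := by
        rw [hR]
        field_simp
        ring



/-! ### The minor arc bound at a fixed `X` -/

/-- The Ramaré coefficient `c(m) = 𝟙_{S₂}(m) g(m)/(ω(m)+1)` has modulus `≤ 1`. [folklore] -/
theorem norm_ramareCoeff_le (Ps : Finset ℕ) (S₂ : ℕ → Prop) [DecidablePred S₂] (g : ℕ → ℂ)
    (hg : ∀ n, ‖g n‖ ≤ 1) (m : ℕ) :
    ‖(if S₂ m then g m / ((#(Ps.filter (· ∣ m)) : ℂ) + 1) else 0)‖ ≤ 1 := by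
  by_cases hS2 : S₂ m
  · rw [if_pos hS2, norm_div]
    have h4 : (1 : ℝ) ≤ ‖((#(Ps.filter (· ∣ m)) : ℂ) + 1)‖ := by
      have h5 : ((#(Ps.filter (· ∣ m)) : ℂ) + 1) = (((#(Ps.filter (· ∣ m)) + 1 : ℕ)) : ℂ) := by
        push_cast; ring
      rw [h5, Complex.norm_natCast]
      exact_mod_cast Nat.le_add_left 1 _
    calc ‖g m‖ / ‖((#(Ps.filter (· ∣ m)) : ℂ) + 1)‖ ≤ ‖g m‖ / 1 :=
          div_le_div_of_nonneg_left (norm_nonneg _) one_pos h4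
      _ ≤ 1 := by rw [div_one]; exact hg m
  · rw [if_neg hS2, norm_zero]; exact zero_le_one

/-- `#{p ∈ Q} ≤ π(N)` for a set `Q` of primes `≤ N`. [folklore] -/
theorem card_le_primeCounting_of_prime (Q : Finset ℕ) {N : ℕ} (hQ : ∀ p ∈ Q, p.Prime ∧ p ≤ N) :
    #Q ≤ Nat.primeCounting N := by
  have h : Q ⊆ Nat.primesBelow (N + 1) := by
    intro p hp
    obtain ⟨hpr, hpN⟩ := hQ p hp
    rw [Nat.primesBelow, Finset.mem_filter, Finset.mem_range]
    exact ⟨by omega, hpr⟩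
  calc #Q ≤ #(Nat.primesBelow (N + 1)) := Finset.card_le_card h
    _ = Nat.primeCounting N := by
        rw [Nat.primesBelow_card_eq_primeCounting']; rfl

/-- `∑_{p ∈ Ps} 1/p² ≤ 2/A` when all elements of `Ps` are `≥ A ≥ 1`. [folklore] -/
theorem sum_inv_sq_le_of_le (Ps : Finset ℕ) {A : ℕ} (hA : 1 ≤ A) (hPs : ∀ p ∈ Ps, A ≤ p) :
    ∑ p ∈ Ps, 1 / ((p : ℝ) ^ 2) ≤ (2 : ℝ) / (A : ℝ) := by
  classical
  obtain ⟨N, hN⟩ : ∃ N, ∀ p ∈ Ps, p < N :=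
    ⟨Ps.sup id + 1, fun p hp => Nat.lt_succ_of_le (Finset.le_sup (f := id) hp)⟩
  have hsub : Ps ⊆ Ioo (A - 1) N := by
    intro p hp
    rw [Finset.mem_Ioo]
    exact ⟨by have := hPs p hp; omega, hN p hp⟩
  calc ∑ p ∈ Ps, 1 / ((p : ℝ) ^ 2) ≤ ∑ p ∈ Ioo (A - 1) N, 1 / ((p : ℝ) ^ 2) :=
        Finset.sum_le_sum_of_subset_of_nonneg hsub fun p _ _ => by positivity
    _ = ∑ p ∈ Ioo (A - 1) N, ((p : ℝ) ^ 2)⁻¹ := by simp_rw [one_div]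
    _ ≤ 2 / ((A - 1 : ℕ) + 1) := sum_Ioo_inv_sq_le _ _
    _ = (2 : ℝ) / (A : ℝ) := by
        congr 1
        rw [Nat.cast_sub hA]; push_cast; ring

/-- `J = ⌊log₂ ⌊Q₁⌋⌋` satisfies `J + 1 ≤ 3 log H` when `Q₁ ≤ H` and `H ≥ 3`. [folklore] -/
theorem log_two_floor_add_one_le {Q₁ : ℝ} {H : ℕ} (hH : 3 ≤ H) (hQ₁H : Q₁ ≤ H) :
    (((Nat.log 2 ⌊Q₁⌋₊ + 1 : ℕ)) : ℝ) ≤ 3 * Real.log H := by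
  have hH3 : (3 : ℝ) ≤ H := by exact_mod_cast hH
  have hlogH : 1 ≤ Real.log H := by
    rw [Real.le_log_iff_exp_le (by linarith)]
    have := Real.exp_one_lt_d9
    linarith
  rcases Nat.eq_zero_or_pos ⌊Q₁⌋₊ with h0 | h0
  · rw [h0, Nat.log_zero_right]; push_cast; linarith
  · set J := Nat.log 2 ⌊Q₁⌋₊ with hJ
    have h1 : 2 ^ J ≤ ⌊Q₁⌋₊ := Nat.pow_log_le_self 2 h0.ne'
    have h2 : ((2 : ℝ)) ^ J ≤ (H : ℝ) := by
      calc ((2 : ℝ)) ^ J = ((2 ^ J : ℕ) : ℝ) := by push_cast; ring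
        _ ≤ (⌊Q₁⌋₊ : ℝ) := by exact_mod_cast h1
        _ ≤ Q₁ := Nat.floor_le (by
            have : (0 : ℝ) < ⌊Q₁⌋₊ := by exact_mod_cast h0
            have := Nat.floor_pos.mp h0
            linarith)
        _ ≤ H := hQ₁H
    have h3 : (J : ℝ) * Real.log 2 ≤ Real.log H := by
      rw [← Real.log_pow]
      exact Real.log_le_log (by positivity) h2
    have h4 := two_thirds_le_log_two
    have hJ0 : (0 : ℝ) ≤ J := Nat.cast_nonneg J
    have h5 : (J : ℝ) * (2 / 3) ≤ Real.log H :=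
      (mul_le_mul_of_nonneg_left h4 hJ0).trans h3
    push_cast
    linarith

/-- **The error term of the Ramaré step** (p. 9: "We may replace `𝟙_{p ∤ m}` with `1` … at a cost of
`O(HX/dP)`"): `2 ∑_k ∑_{p ∈ Ps} #windowDiv (dp²) H k ≤ 8 HX log H/(d√W)` when the elements of `Ps`
are `≥ P₁ = W³³ ≥ √W` (`∑_{p ≥ P₁} 1/p² ≤ 2/P₁`, `log H ≥ 1`). [cite: Lichtman2020, §3.1, p. 9] -/
theorem ramare_error_le {X d H : ℕ} {W P₁ : ℝ} (hW : 2 ≤ W) (hd : 1 ≤ d) (hP₁ : P₁ = W ^ 33)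
    (hH : 3 ≤ H) (hHX : H ≤ X) (Ps : Finset ℕ) (hPs : ∀ p ∈ Ps, p.Prime)
    (hPsb : ∀ p ∈ Ps, P₁ ≤ (p : ℝ)) :
    2 * ∑ k ∈ Icc 1 X, ∑ p ∈ Ps, (#(windowDiv (d * p * p) H k) : ℝ) ≤
      8 * ((H : ℝ) * X * Real.log H / (d * Real.sqrt W)) := by
  have hW0 : 0 < W := by linarith
  have hW1 : 1 ≤ W := by linarith
  have hd0 : (0 : ℝ) < d := by exact_mod_cast hd
  have hH3 : (3 : ℝ) ≤ H := by exact_mod_cast hH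
  have hH0 : (0 : ℝ) < H := by linarith
  have hH1 : 1 ≤ H := by omega
  have hHX' : (H : ℝ) ≤ X := by exact_mod_cast hHX
  have hlogH : 1 ≤ Real.log H := by
    rw [Real.le_log_iff_exp_le hH0]
    have := Real.exp_one_lt_d9
    linarith
  have hP₁1 : 1 ≤ P₁ := by rw [hP₁]; exact one_le_pow₀ hW1
  have hP₁0 : 0 < P₁ := by linarith
  have hsqW : 0 < Real.sqrt W := Real.sqrt_pos.mpr hW0
  rw [Finset.sum_comm]
  have h1 : ∀ p ∈ Ps, ∑ k ∈ Icc 1 X, (#(windowDiv (d * p * p) H k) : ℝ) ≤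
      (H : ℝ) * ((X : ℝ) + H) / d * (1 / (p : ℝ) ^ 2) := by
    intro p hp
    have hp1 := (hPs p hp).one_le
    have h := sum_card_windowDiv_le X H (d * p * p) (Nat.mul_pos (Nat.mul_pos hd hp1) hp1) hH1
    refine h.trans (le_of_eq ?_)
    have hp0 : (0 : ℝ) < p := by exact_mod_cast hp1
    push_cast
    field_simp
  have hA1 : 1 ≤ ⌈P₁⌉₊ := Nat.ceil_pos.mpr hP₁0
  have h2 : ∑ p ∈ Ps, 1 / ((p : ℝ) ^ 2) ≤ 2 / P₁ := by
    have h3 := sum_inv_sq_le_of_le Ps hA1 (fun p hp => Nat.ceil_le.mpr (hPsb p hp))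
    exact h3.trans (div_le_div_of_nonneg_left (by norm_num : (0 : ℝ) ≤ 2) hP₁0 (Nat.le_ceil P₁))
  have hsqrtP₁ : Real.sqrt W ≤ P₁ := by
    rw [hP₁]
    calc Real.sqrt W ≤ W := by
          rw [Real.sqrt_le_left (by linarith)]
          nlinarith
      _ ≤ W ^ 33 := le_self_pow₀ hW1 (by norm_num)
  calc 2 * ∑ p ∈ Ps, ∑ k ∈ Icc 1 X, (#(windowDiv (d * p * p) H k) : ℝ)
      ≤ 2 * ∑ p ∈ Ps, (H : ℝ) * ((X : ℝ) + H) / d * (1 / (p : ℝ) ^ 2) :=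
        mul_le_mul_of_nonneg_left (Finset.sum_le_sum h1) (by norm_num)
    _ = 2 * ((H : ℝ) * ((X : ℝ) + H) / d) * ∑ p ∈ Ps, 1 / (p : ℝ) ^ 2 := by
        rw [← Finset.mul_sum]; ring
    _ ≤ 2 * ((H : ℝ) * ((X : ℝ) + H) / d) * (2 / P₁) :=
        mul_le_mul_of_nonneg_left h2 (by positivity)
    _ ≤ 2 * ((H : ℝ) * (2 * X) / d) * (2 * (Real.log H / Real.sqrt W)) := by
        apply mul_le_mul _ _ (by positivity) (by positivity)
        · apply mul_le_mul_of_nonneg_left _ (by norm_num)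
          apply div_le_div_of_nonneg_right _ hd0.le
          nlinarith
        · rw [div_eq_mul_one_div]
          apply mul_le_mul_of_nonneg_left _ (by norm_num)
          rw [div_le_div_iff₀ hP₁0 hsqW]
          nlinarith
    _ = 8 * ((H : ℝ) * X * Real.log H / (d * Real.sqrt W)) := by
        field_simp
        ring

/-- **One dyadic block on the minor arcs**: for a nonempty block `Q` of primes in `[2^j, 2^{j+1})`
with `W³³/2 ≤ 2^j ≤ Q₁ = H/W⁴`, and `α ∈ 𝔪(W, Q₁)`,
`∑_k |G_j(k)| ≤ 86 · HX √(1 + 2 log H)/(d√W) · (j+1)^{-1/2}` (`core_block_bound`,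
`sum_sum_geomBound_sub_le`, Vinogradov's lemma, Chebyshev's `π(2P) ≤ 12P/log(2P)`,
`block_numeric_bound`, `log(2·2^j) = (j+1) log 2`). [cite: Lichtman2020, §3.1, (3.4)–(3.6)] -/
theorem block_bound {X d H j : ℕ} {W Q₁ : ℝ} (hW : 2 ≤ W) (hd : 1 ≤ d) (hdW : (d : ℝ) ≤ W)
    (hQ₁ : Q₁ = H / W ^ 4) (hH : 3 ≤ H) (hHX : H ≤ X) (Q : Finset ℕ)
    (hQpr : ∀ p ∈ Q, p.Prime) (hQ : ∀ p ∈ Q, 2 ^ j ≤ p ∧ p < 2 * 2 ^ j)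
    (hPW : W ^ 33 / 2 ≤ (2 : ℝ) ^ j) (hPQ : (2 : ℝ) ^ j ≤ Q₁) (hQ₁1 : 1 ≤ Q₁)
    (c w : ℕ → ℂ) (hc : ∀ m, ‖c m‖ ≤ 1) (hw : ∀ p, ‖w p‖ ≤ 1)
    {α : ℝ} (hα : α ∈ lichtmanMinorArcs W Q₁) :
    ∑ k ∈ Icc 1 X, ‖∑ p ∈ Q, ∑ m ∈ windowDiv (d * p) H k,
        c m * w p * (𝐞 (((m * p : ℕ) : ℝ) * α) : ℂ)‖ ≤
      86 * ((H : ℝ) * X * Real.sqrt (1 + 2 * Real.log H) / (d * Real.sqrt W)) *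
        (1 / Real.sqrt ((j : ℝ) + 1)) := by
  have hW0 : 0 < W := by linarith
  have hd1 : (1 : ℝ) ≤ d := by exact_mod_cast hd
  have hH3 : (3 : ℝ) ≤ H := by exact_mod_cast hH
  have hH0 : (0 : ℝ) < H := by linarith
  have hHX' : (H : ℝ) ≤ X := by exact_mod_cast hHX
  have hlogH : 1 ≤ Real.log H := by
    rw [Real.le_log_iff_exp_le hH0]
    have := Real.exp_one_lt_d9
    linarith
  set Λ : ℝ := 1 + 2 * Real.log H with hΛ
  have hΛ1 : 1 ≤ Λ := by rw [hΛ]; linarith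
  have hP1 : 1 ≤ 2 ^ j := Nat.one_le_two_pow
  have hP0 : (0 : ℝ) < (2 : ℝ) ^ j := by positivity
  have hdP0 : (0 : ℝ) < (d : ℝ) * (2 : ℝ) ^ j := by positivity
  have hrhs0 : 0 ≤ 86 * ((H : ℝ) * X * Real.sqrt Λ / (d * Real.sqrt W)) *
      (1 / Real.sqrt ((j : ℝ) + 1)) := by positivity
  -- the core estimate and the abbreviations `M, U, V, L₁`
  have hcore := core_block_bound (X := X) (H := H) hd hP1 Q hQ c w hc hw α
  set M : ℕ := (X + H - 1) / (d * 2 ^ j) with hMdef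
  set Un : ℕ := (H - 1) / (d * 2 ^ j) with hUndef
  set U : ℝ := (Un : ℝ) + 1 with hUdef
  have hU0 : 0 ≤ U := by positivity
  have hV1 := sum_sum_geomBound_sub_le Q hQ hU0 α
  have hV2 := sum_geomBound_const_le_of_mem_minorArcs hW0 hQ₁1 hα hU0 hP1
  push_cast at hV2
  set V : ℝ := ∑ p₁ ∈ Q, ∑ p₂ ∈ Q, Vinogradov.geomBound U (((p₁ : ℝ) - p₂) * α) with hVdef
  set L₁ : ℝ := 1 + Real.log (Q₁ * (2 * (2 : ℝ) ^ j)) with hL₁def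
  -- the hypotheses of the numeric lemma
  have hM : (M : ℝ) ≤ ((X : ℝ) + H) / ((d : ℝ) * (2 : ℝ) ^ j) := by
    rw [le_div_iff₀ hdP0]
    have h1 : M * (d * 2 ^ j) ≤ X + H - 1 := Nat.div_mul_le_self _ _
    have h2 : ((M * (d * 2 ^ j) : ℕ) : ℝ) ≤ ((X + H - 1 : ℕ) : ℝ) := by exact_mod_cast h1
    have h3 : ((X + H - 1 : ℕ) : ℝ) ≤ (X : ℝ) + H := by
      rw [Nat.cast_sub (by omega), Nat.cast_add]; simp
    push_cast at h2
    linarith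
  have hU : U ≤ (H : ℝ) / ((d : ℝ) * (2 : ℝ) ^ j) + 1 := by
    rw [hUdef, add_le_add_iff_right, le_div_iff₀ hdP0]
    have h1 : Un * (d * 2 ^ j) ≤ H - 1 := Nat.div_mul_le_self _ _
    have h2 : ((Un * (d * 2 ^ j) : ℕ) : ℝ) ≤ ((H - 1 : ℕ) : ℝ) := by exact_mod_cast h1
    have h3 : ((H - 1 : ℕ) : ℝ) ≤ (H : ℝ) := by exact_mod_cast Nat.sub_le H 1
    push_cast at h2
    linarith
  have hcQ0 : (0 : ℝ) ≤ (#Q : ℝ) := Nat.cast_nonneg _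
  have hV : V ≤ #Q * U + 2 * #Q * (4 * (2 * (2 : ℝ) ^ j * U / W + 2 * (2 : ℝ) ^ j + Q₁) * L₁) := by
    have h2c : (0 : ℝ) ≤ 2 * (#Q : ℝ) := by linarith
    have h3 := mul_le_mul_of_nonneg_left hV2 h2c
    rw [hL₁def]
    calc V ≤ _ := hV1
      _ ≤ _ := by linarith
  have hQ0 : 0 ≤ Q₁ := by linarith
  have hQP2 : Q₁ * (2 * (2 : ℝ) ^ j) ≤ (H : ℝ) ^ 2 := by
    have hW8 : (2 : ℝ) ^ 8 ≤ W ^ 8 := pow_le_pow_left₀ (by norm_num) hW 8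
    have h1 : Q₁ * (2 * (2 : ℝ) ^ j) ≤ Q₁ * (2 * Q₁) :=
      mul_le_mul_of_nonneg_left (by linarith) hQ0
    have h2 : Q₁ * (2 * Q₁) = 2 * (H : ℝ) ^ 2 / W ^ 8 := by rw [hQ₁]; field_simp
    have h3 : 2 * (H : ℝ) ^ 2 / W ^ 8 ≤ (H : ℝ) ^ 2 := by
      rw [div_le_iff₀ (by positivity)]
      have hH2 : (0 : ℝ) ≤ (H : ℝ) ^ 2 := by positivity
      have : (H : ℝ) ^ 2 * 2 ≤ (H : ℝ) ^ 2 * W ^ 8 :=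
        mul_le_mul_of_nonneg_left (by linarith [show (2 : ℝ) ≤ 2 ^ 8 by norm_num]) hH2
      linarith
    linarith
  have hQP1 : 1 ≤ Q₁ * (2 * (2 : ℝ) ^ j) := by
    have h1 : (1 : ℝ) ≤ (2 : ℝ) ^ j := one_le_pow₀ (by norm_num)
    have h2 : (1 : ℝ) * 1 ≤ Q₁ * (2 * (2 : ℝ) ^ j) :=
      mul_le_mul hQ₁1 (by linarith) zero_le_one hQ0
    linarith
  have hL₁Λ : L₁ ≤ Λ := by
    rw [hL₁def, hΛ]
    have h := Real.log_le_log (by linarith) hQP2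
    rw [Real.log_pow] at h
    push_cast at h
    linarith
  have hL₁0 : 0 ≤ L₁ := by
    rw [hL₁def]
    have := Real.log_nonneg hQP1
    linarith
  have h2P2 : 2 ≤ 2 * 2 ^ j := by omega
  have h2P2' : (2 : ℝ) ≤ 2 * (2 : ℝ) ^ j := by
    have h1 : (1 : ℝ) ≤ (2 : ℝ) ^ j := one_le_pow₀ (by norm_num)
    linarith
  have hlog2P : 0 < Real.log (2 * (2 : ℝ) ^ j) := Real.log_pos (by linarith)
  have hcard : (#Q : ℝ) ≤ 12 * (2 : ℝ) ^ j / Real.log (2 * (2 : ℝ) ^ j) := by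
    have h1 : #Q ≤ Nat.primeCounting (2 * 2 ^ j) :=
      card_le_primeCounting_of_prime Q (fun p hp => ⟨hQpr p hp, (hQ p hp).2.le⟩)
    have h2 := primeCounting_le_six_mul_div_log h2P2
    push_cast at h2
    calc (#Q : ℝ) ≤ Nat.primeCounting (2 * 2 ^ j) := by exact_mod_cast h1
      _ ≤ 6 * ((2 * (2 : ℝ) ^ j) / Real.log (2 * 2 ^ j)) := h2
      _ = 12 * (2 : ℝ) ^ j / Real.log (2 * 2 ^ j) := by ring
  have hnum := block_numeric_bound (X := (X : ℝ)) (H := (H : ℝ)) (d := (d : ℝ)) hW hd1 hdW hPW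
    hPQ hQ₁ hHX' (Nat.cast_nonneg M) hM hU0 hU hcQ0 hlog2P hcard hL₁0 hL₁Λ hΛ1 hV
  -- `√(4920 K/((j+1) log 2)) ≤ 86 √K/√(j+1)`
  have hlogeq : Real.log (2 * (2 : ℝ) ^ j) = ((j : ℝ) + 1) * Real.log 2 := by
    rw [← pow_succ', Real.log_pow]
    push_cast
    ring
  have hj0 : (0 : ℝ) < (j : ℝ) + 1 := by positivity
  have hsq : 4920 * ((H : ℝ) ^ 2 * (X : ℝ) ^ 2 * Λ / ((d : ℝ) ^ 2 * W * Real.log (2 * (2 : ℝ) ^ j))) ≤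
      (86 * ((H : ℝ) * X * Real.sqrt Λ / (d * Real.sqrt W)) * (1 / Real.sqrt ((j : ℝ) + 1))) ^ 2 := by
    have hK0 : 0 ≤ (H : ℝ) ^ 2 * (X : ℝ) ^ 2 * Λ / ((d : ℝ) ^ 2 * W) := by positivity
    have hrhs : (86 * ((H : ℝ) * X * Real.sqrt Λ / (d * Real.sqrt W)) *
        (1 / Real.sqrt ((j : ℝ) + 1))) ^ 2 =
        7396 / ((j : ℝ) + 1) * ((H : ℝ) ^ 2 * (X : ℝ) ^ 2 * Λ / ((d : ℝ) ^ 2 * W)) := by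
      rw [mul_pow, mul_pow, div_pow, div_pow, mul_pow, mul_pow, mul_pow, one_pow,
        Real.sq_sqrt (by linarith), Real.sq_sqrt hW0.le, Real.sq_sqrt hj0.le]
      field_simp
      ring
    have hlhs : 4920 * ((H : ℝ) ^ 2 * (X : ℝ) ^ 2 * Λ /
        ((d : ℝ) ^ 2 * W * Real.log (2 * (2 : ℝ) ^ j))) =
        4920 / Real.log (2 * (2 : ℝ) ^ j) * ((H : ℝ) ^ 2 * (X : ℝ) ^ 2 * Λ / ((d : ℝ) ^ 2 * W)) := by
      field_simp
    rw [hrhs, hlhs]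
    apply mul_le_mul_of_nonneg_right _ hK0
    rw [div_le_div_iff₀ hlog2P hj0, hlogeq]
    have h4 := two_thirds_le_log_two
    have h5 : ((j : ℝ) + 1) * (2 / 3) ≤ ((j : ℝ) + 1) * Real.log 2 :=
      mul_le_mul_of_nonneg_left h4 hj0.le
    linarith
  calc ∑ k ∈ Icc 1 X, ‖∑ p ∈ Q, ∑ m ∈ windowDiv (d * p) H k,
        c m * w p * (𝐞 (((m * p : ℕ) : ℝ) * α) : ℂ)‖ ≤ Real.sqrt ((M : ℝ) * (5 * H * X * V)) := hcore
    _ ≤ Real.sqrt (4920 * ((H : ℝ) ^ 2 * (X : ℝ) ^ 2 * Λ /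
        ((d : ℝ) ^ 2 * W * Real.log (2 * (2 : ℝ) ^ j)))) := Real.sqrt_le_sqrt hnum
    _ ≤ Real.sqrt ((86 * ((H : ℝ) * X * Real.sqrt Λ / (d * Real.sqrt W)) *
        (1 / Real.sqrt ((j : ℝ) + 1))) ^ 2) := Real.sqrt_le_sqrt hsq
    _ = 86 * ((H : ℝ) * X * Real.sqrt Λ / (d * Real.sqrt W)) *
        (1 / Real.sqrt ((j : ℝ) + 1)) := Real.sqrt_sq hrhs0

/-- **The minor arc bound of Lichtman 2020, §3.1, at a fixed `X` (discrete form).**  Let `2 ≤ W`,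
`1 ≤ d ≤ W`, `P₁ = W³³`, `Q₁ = H/W⁴ < P₂`, `3 ≤ H ≤ X`, `S(n) ⟺` (`n` has a prime factor in
`[P₁, Q₁]` and one in `[P₂, Q₂]`), `g` completely multiplicative with `|g| ≤ 1`, `α ∈ 𝔪(W, Q₁)`.
Then `∑_{k ≤ X} |∑_{n ∈ windowDiv d H k ∩ S} g(n) e(nα)| ≤ 600 · HX log H/(d √W)`.
(The paper's (3.1) is `≪ HX (log log X/(dW))^{1/2} ψ(X)`; the present form, with `1/d` for
`1/√d` and `log H` for `√(log log X) ψ(X)`, comes from the explicit Vinogradov lemma with its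
logarithm and the trivial count of prime pairs, and suffices for Theorem 2.2.)
[cite: Lichtman2020, §3.1, (3.1)–(3.6)] -/
theorem minorArc_sum_le {X d H : ℕ} {W P₁ Q₁ P₂ Q₂ : ℝ} (hW : 2 ≤ W) (hd : 1 ≤ d)
    (hdW : (d : ℝ) ≤ W) (hP₁ : P₁ = W ^ 33) (hQ₁ : Q₁ = H / W ^ 4) (hQP : Q₁ < P₂)
    (hH : 3 ≤ H) (hHX : H ≤ X) (S : ℕ → Prop) [DecidablePred S]
    (hSiff : ∀ n, S n ↔ HasPrimeFactorIn P₁ Q₁ n ∧ HasPrimeFactorIn P₂ Q₂ n)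
    (g : ℕ → ℂ) (hgmul : ∀ m n, g (m * n) = g m * g n) (hg : ∀ n, ‖g n‖ ≤ 1)
    {α : ℝ} (hα : α ∈ lichtmanMinorArcs W Q₁) :
    ∑ k ∈ Icc 1 X, ‖twistedSum g ((windowDiv d H k).filter S) α‖ ≤
      600 * ((H : ℝ) * X * Real.log H / (d * Real.sqrt W)) := by
  classical
  -- basic real facts
  have hW0 : 0 < W := by linarith
  have hW1 : 1 ≤ W := by linarith
  have hH3 : (3 : ℝ) ≤ H := by exact_mod_cast hH
  have hH0 : (0 : ℝ) < H := by linarith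
  have hlogH : 1 ≤ Real.log H := by
    rw [Real.le_log_iff_exp_le hH0]
    have := Real.exp_one_lt_d9
    linarith
  have hP₁1 : 1 ≤ P₁ := by rw [hP₁]; exact one_le_pow₀ hW1
  have hQ₁H : Q₁ ≤ H := by
    rw [hQ₁]
    exact div_le_self hH0.le (one_le_pow₀ hW1)
  have hΛ3 : 1 + 2 * Real.log H ≤ 3 * Real.log H := by linarith
  -- the primes of `[P₁, Q₁]`
  set Ps : Finset ℕ := (Finset.range (⌊Q₁⌋₊ + 1)).filter
    (fun p => p.Prime ∧ P₁ ≤ (p : ℝ) ∧ (p : ℝ) ≤ Q₁) with hPs_def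
  have hPs : ∀ p ∈ Ps, p.Prime := fun p hp => (Finset.mem_filter.mp hp).2.1
  have hPsb : ∀ p ∈ Ps, P₁ ≤ (p : ℝ) ∧ (p : ℝ) ≤ Q₁ := fun p hp => (Finset.mem_filter.mp hp).2.2
  have hPsQ : ∀ p ∈ Ps, p ≤ ⌊Q₁⌋₊ := fun p hp => by
    have := Finset.mem_range.mp (Finset.mem_filter.mp hp).1; omega
  have hS : ∀ n, S n → n ≠ 0 ∧ ∃ p ∈ Ps, p ∣ n := by
    intro n hn
    obtain ⟨⟨p, hp, hP, hQ⟩, -⟩ := (hSiff n).mp hn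
    obtain ⟨hpr, hpn, hn0⟩ := Nat.mem_primeFactors.mp hp
    refine ⟨hn0, p, ?_, hpn⟩
    rw [hPs_def, Finset.mem_filter, Finset.mem_range]
    refine ⟨?_, hpr, hP, hQ⟩
    have : p ≤ ⌊Q₁⌋₊ := Nat.le_floor hQ
    omega
  have hS₂ : ∀ p ∈ Ps, ∀ m, m ≠ 0 → (S (m * p) ↔ HasPrimeFactorIn P₂ Q₂ m) := by
    intro p hp m hm
    have hpr := hPs p hp
    obtain ⟨hP, hQ⟩ := hPsb p hp
    rw [hSiff]
    have h1 : HasPrimeFactorIn P₁ Q₁ (m * p) :=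
      ⟨p, Nat.mem_primeFactors.mpr ⟨hpr, dvd_mul_left p m, Nat.mul_ne_zero hm hpr.ne_zero⟩, hP, hQ⟩
    have h2 : HasPrimeFactorIn P₂ Q₂ (m * p) ↔ HasPrimeFactorIn P₂ Q₂ m := by
      rw [mul_comm]
      apply hasPrimeFactorIn_mul_iff hpr.ne_zero
      intro q hq
      rw [Nat.Prime.primeFactors hpr, Finset.mem_singleton] at hq
      rw [hq]; exact lt_of_le_of_lt hQ hQP
    rw [h2]
    exact ⟨fun h => h.2, fun h => ⟨h1, h⟩⟩
  -- the Ramaré coefficients and the dyadic blocks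
  set c : ℕ → ℂ := fun m => if HasPrimeFactorIn P₂ Q₂ m then
    g m / ((#(Ps.filter (· ∣ m)) : ℂ) + 1) else 0 with hc
  have hcle : ∀ m, ‖c m‖ ≤ 1 := fun m => norm_ramareCoeff_le Ps (HasPrimeFactorIn P₂ Q₂) g hg m
  set J : ℕ := Nat.log 2 ⌊Q₁⌋₊ with hJ
  have hJ3 : (((J + 1 : ℕ)) : ℝ) ≤ 3 * Real.log H := log_two_floor_add_one_le hH hQ₁H
  set Qj : ℕ → Finset ℕ := fun j => Ps.filter (fun p => Nat.log 2 p = j) with hQj_def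
  have hQjP : ∀ j, ∀ p ∈ Qj j, p ∈ Ps := fun j p hp => (Finset.mem_filter.mp hp).1
  have hQj : ∀ j, ∀ p ∈ Qj j, 2 ^ j ≤ p ∧ p < 2 * 2 ^ j := by
    intro j p hp
    obtain ⟨hpP, hj⟩ := Finset.mem_filter.mp hp
    subst hj
    have hp0 : p ≠ 0 := (hPs p hpP).ne_zero
    refine ⟨Nat.pow_log_le_self 2 hp0, ?_⟩
    rw [← pow_succ']
    exact Nat.lt_pow_succ_log_self one_lt_two p
  have hmaps : ∀ p ∈ Ps, Nat.log 2 p ∈ Finset.range (J + 1) := by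
    intro p hp
    rw [Finset.mem_range, Nat.lt_succ_iff, hJ]
    exact Nat.log_mono_right (hPsQ p hp)
  set G : ℕ → ℕ → ℂ := fun j k => ∑ p ∈ Qj j, ∑ m ∈ windowDiv (d * p) H k,
      c m * g p * (𝐞 (((m * p : ℕ) : ℝ) * α) : ℂ) with hG
  -- Step 1: per-window decomposition
  have hdecomp : ∀ k ∈ Icc 1 X, ‖twistedSum g ((windowDiv d H k).filter S) α‖ ≤
      ∑ j ∈ Finset.range (J + 1), ‖G j k‖ +
        2 * ∑ p ∈ Ps, (#(windowDiv (d * p * p) H k) : ℝ) := by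
    intro k hk
    have hk1 : 1 ≤ k := (Finset.mem_Icc.mp hk).1
    have hR := norm_twistedSum_sub_ramare_le (d := d) (H := H) hk1 Ps hPs S
      (HasPrimeFactorIn P₂ Q₂) hS hS₂ g hgmul hg α c (fun m => rfl)
    have hmain : ∑ p ∈ Ps, ∑ m ∈ windowDiv (d * p) H k,
        c m * g p * (𝐞 (((m * p : ℕ) : ℝ) * α) : ℂ) = ∑ j ∈ Finset.range (J + 1), G j k := by
      simp only [hG, hQj_def]
      exact (Finset.sum_fiberwise_of_maps_to hmaps _).symm
    calc ‖twistedSum g ((windowDiv d H k).filter S) α‖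
        = ‖(twistedSum g ((windowDiv d H k).filter S) α -
            ∑ p ∈ Ps, ∑ m ∈ windowDiv (d * p) H k,
              c m * g p * (𝐞 (((m * p : ℕ) : ℝ) * α) : ℂ)) +
            ∑ j ∈ Finset.range (J + 1), G j k‖ := by rw [← hmain, sub_add_cancel]
      _ ≤ 2 * ∑ p ∈ Ps, (#(windowDiv (d * p * p) H k) : ℝ) +
            ∑ j ∈ Finset.range (J + 1), ‖G j k‖ :=
          (norm_add_le _ _).trans (add_le_add hR (norm_sum_le _ _))
      _ = _ := by ring
  -- Step 2: the error term
  have herr := ramare_error_le (X := X) hW hd hP₁ hH hHX Ps hPs (fun p hp => (hPsb p hp).1)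
  -- Step 3: the blocks
  have hY0 : 0 ≤ (H : ℝ) * X * Real.sqrt (1 + 2 * Real.log H) / (d * Real.sqrt W) := by positivity
  have hblock : ∀ j ∈ Finset.range (J + 1), ∑ k ∈ Icc 1 X, ‖G j k‖ ≤
      86 * ((H : ℝ) * X * Real.sqrt (1 + 2 * Real.log H) / (d * Real.sqrt W)) *
        (1 / Real.sqrt ((j : ℝ) + 1)) := by
    intro j _
    rcases (Qj j).eq_empty_or_nonempty with hempty | ⟨p₀, hp₀⟩
    · -- empty block
      have h0 : ∀ k, G j k = 0 := fun k =>
        Finset.sum_eq_zero fun p hp => absurd hp (by rw [hempty]; exact Finset.notMem_empty p)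
      rw [Finset.sum_eq_zero (fun k _ => by rw [h0 k, norm_zero])]
      positivity
    · -- a nonempty block: `2^j ≥ P₁/2`, `2^j ≤ Q₁`
      obtain ⟨hp₀P, -⟩ := hQj j p₀ hp₀
      obtain ⟨hp₀P₁, hp₀Q₁⟩ := hPsb p₀ (hQjP j p₀ hp₀)
      have hPp₀ : (2 : ℝ) ^ j ≤ p₀ := by exact_mod_cast hp₀P
      have hPQ : (2 : ℝ) ^ j ≤ Q₁ := hPp₀.trans hp₀Q₁
      have hPW : W ^ 33 / 2 ≤ (2 : ℝ) ^ j := by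
        have h2 : (p₀ : ℝ) < 2 * (2 : ℝ) ^ j := by exact_mod_cast (hQj j p₀ hp₀).2
        rw [← hP₁]; linarith
      have hQ₁1 : 1 ≤ Q₁ := hP₁1.trans (hp₀P₁.trans hp₀Q₁)
      exact block_bound hW hd hdW hQ₁ hH hHX (Qj j) (fun p hp => hPs p (hQjP j p hp)) (hQj j)
        hPW hPQ hQ₁1 c g hcle hg hα
  have hblocks : ∑ j ∈ Finset.range (J + 1), ∑ k ∈ Icc 1 X, ‖G j k‖ ≤
      516 * ((H : ℝ) * X * Real.log H / (d * Real.sqrt W)) := by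
    calc ∑ j ∈ Finset.range (J + 1), ∑ k ∈ Icc 1 X, ‖G j k‖
        ≤ ∑ j ∈ Finset.range (J + 1), 86 * ((H : ℝ) * X * Real.sqrt (1 + 2 * Real.log H) /
            (d * Real.sqrt W)) * (1 / Real.sqrt ((j : ℝ) + 1)) := Finset.sum_le_sum hblock
      _ = 86 * ((H : ℝ) * X * Real.sqrt (1 + 2 * Real.log H) / (d * Real.sqrt W)) *
            ∑ j ∈ Finset.range (J + 1), 1 / Real.sqrt ((j : ℝ) + 1) := by rw [Finset.mul_sum]
      _ ≤ 86 * ((H : ℝ) * X * Real.sqrt (1 + 2 * Real.log H) / (d * Real.sqrt W)) *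
            (2 * Real.sqrt ((J + 1 : ℕ) : ℝ)) :=
          mul_le_mul_of_nonneg_left (sum_inv_sqrt_le (J + 1)) (by positivity)
      _ = 172 * ((H : ℝ) * X / (d * Real.sqrt W)) *
            (Real.sqrt (1 + 2 * Real.log H) * Real.sqrt ((J + 1 : ℕ) : ℝ)) := by ring
      _ ≤ 172 * ((H : ℝ) * X / (d * Real.sqrt W)) * (3 * Real.log H) := by
          apply mul_le_mul_of_nonneg_left _ (by positivity)
          calc Real.sqrt (1 + 2 * Real.log H) * Real.sqrt ((J + 1 : ℕ) : ℝ)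
              ≤ Real.sqrt (3 * Real.log H) * Real.sqrt (3 * Real.log H) :=
                mul_le_mul (Real.sqrt_le_sqrt hΛ3) (Real.sqrt_le_sqrt hJ3) (Real.sqrt_nonneg _)
                  (Real.sqrt_nonneg _)
            _ = 3 * Real.log H := Real.mul_self_sqrt (by linarith)
      _ = 516 * ((H : ℝ) * X * Real.log H / (d * Real.sqrt W)) := by ring
  -- assembly
  calc ∑ k ∈ Icc 1 X, ‖twistedSum g ((windowDiv d H k).filter S) α‖
      ≤ ∑ k ∈ Icc 1 X, (∑ j ∈ Finset.range (J + 1), ‖G j k‖ +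
          2 * ∑ p ∈ Ps, (#(windowDiv (d * p * p) H k) : ℝ)) := Finset.sum_le_sum hdecomp
    _ = ∑ j ∈ Finset.range (J + 1), ∑ k ∈ Icc 1 X, ‖G j k‖ +
          2 * ∑ k ∈ Icc 1 X, ∑ p ∈ Ps, (#(windowDiv (d * p * p) H k) : ℝ) := by
        rw [Finset.sum_add_distrib, Finset.sum_comm, Finset.mul_sum]
    _ ≤ 516 * ((H : ℝ) * X * Real.log H / (d * Real.sqrt W)) +
          8 * ((H : ℝ) * X * Real.log H / (d * Real.sqrt W)) := add_le_add hblocks herr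
    _ ≤ 600 * ((H : ℝ) * X * Real.log H / (d * Real.sqrt W)) := by
        have : 0 ≤ (H : ℝ) * X * Real.log H / (d * Real.sqrt W) := by positivity
        linarith

/-! ### The minor arc bound, eventually in `X` -/

open Filter Asymptotics MeasureTheory
open scoped Topology

/-- `H(X) ≥ 3` eventually when `log H(X)/log log X → ∞`. [folklore] -/
theorem eventually_three_le_H {H : ℕ → ℕ}
    (hH : Tendsto (fun X : ℕ => Real.log (H X) / Real.log (Real.log X)) atTop atTop) :
    ∀ᶠ X : ℕ in atTop, 3 ≤ H X := by
  have hll : ∀ᶠ X : ℕ in atTop, 1 ≤ Real.log (Real.log X) :=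
    (Real.tendsto_log_atTop.comp tendsto_log_natCast).eventually_ge_atTop 1
  filter_upwards [tendsto_atTop.1 hH 2, hll, eventually_one_le_H hH] with X h2 hll1 h1
  have hH0 : (0 : ℝ) < H X := by exact_mod_cast h1
  have hlog2 : 2 ≤ Real.log (H X) := by
    rw [le_div_iff₀ (by linarith)] at h2
    nlinarith
  by_contra h3
  push Not at h3
  have h3' : (H X : ℝ) < 3 := by exact_mod_cast h3
  have h4 : Real.log (H X) < Real.log 3 := Real.log_lt_log hH0 h3'
  have h5 : Real.log 3 ≤ 3 - 1 := Real.log_le_sub_one_of_pos (by norm_num)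
  linarith

/-- **The minor arc bound, eventually** (the regime of Proposition 3.1 / (3.1): `A > 0`, `δ ≥ 0`,
`ψ(X) = log H/log log X → ∞`, `H ≤ exp((log X)^{2/3})`): for `X` large, all `1 ≤ d ≤ W = (log X)^A`,
all completely multiplicative `|g| ≤ 1` and all `α ∈ 𝔪(W, H/W⁴)`,
`∫₀^X |∑_{x ≤ nd ≤ x+H, n ∈ S_d} g(n) e(nα)| dx ≤ 600 HX log H/(d√W)` (discretised by
`integral_window_div_eq_sum`, then `minorArc_sum_le`; `Q₁ = H/W⁴ < H ≤ P₂` in the regime).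
[cite: Lichtman2020, Proposition 3.1 and (3.1)] -/
theorem minorArc_integral_le (A : ℝ) (hA : 0 < A) (δ : ℝ) (hδ : 0 ≤ δ) (H : ℕ → ℕ)
    (hH : Tendsto (fun X : ℕ => Real.log (H X) / Real.log (Real.log X)) atTop atTop)
    (hHexp : ∀ᶠ X : ℕ in atTop, (H X : ℝ) ≤ Real.exp (Real.log X ^ (2 / 3 : ℝ))) :
    ∀ᶠ X : ℕ in atTop, ∀ d : ℕ, 1 ≤ d → (d : ℝ) ≤ Real.log X ^ A →
      ∀ g : ℕ → ℂ, (∀ m n : ℕ, g (m * n) = g m * g n) → (∀ n : ℕ, ‖g n‖ ≤ 1) →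
      ∀ α ∈ lichtmanMinorArcs (Real.log X ^ A) ((H X : ℝ) / Real.log X ^ (4 * A)),
        ∫ x in (0 : ℝ)..X,
            ‖twistedSum g ((Icc ⌈x / d⌉₊ ⌊(x + H X) / d⌋₊).filter (lichtmanTypical X A δ (H X))) α‖
          ≤ 600 * ((H X : ℝ) * X * Real.log (H X) / (d * Real.sqrt (Real.log X ^ A))) := by
  have hW2 : ∀ᶠ X : ℕ in atTop, 2 ≤ Real.log X ^ A :=
    ((tendsto_rpow_atTop hA).comp tendsto_log_natCast).eventually_ge_atTop 2
  filter_upwards [hHexp, hW2, eventually_three_le_H hH, tendsto_log_natCast.eventually_ge_atTop 1,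
    eventually_gt_atTop 0] with X hHX hW2X h3 hL1 hX0 d hd hdW g hgmul hg α hα
  have hX0' : (0 : ℝ) < X := by exact_mod_cast hX0
  have hL0 : 0 < Real.log X := by linarith
  set L : ℝ := Real.log X with hL
  set W : ℝ := L ^ A with hW
  have hW0 : 0 < W := by rw [hW]; exact Real.rpow_pos_of_pos hL0 _
  have hH0 : (0 : ℝ) < H X := by
    have : (3 : ℝ) ≤ H X := by exact_mod_cast h3
    linarith
  -- the parameters of `minorArc_sum_le`
  have hP₁ : L ^ (33 * A) = W ^ 33 := by
    rw [hW, ← Real.rpow_natCast, ← Real.rpow_mul hL0.le]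
    norm_num
    ring_nf
  have hW4 : L ^ (4 * A) = W ^ 4 := by
    rw [hW, ← Real.rpow_natCast, ← Real.rpow_mul hL0.le]
    norm_num
    ring_nf
  have hQ₁ : (H X : ℝ) / L ^ (4 * A) = (H X : ℝ) / W ^ 4 := by rw [hW4]
  have hHleX : H X ≤ X := by
    have h2 : L ^ (2 / 3 : ℝ) ≤ L := by
      calc L ^ (2 / 3 : ℝ) ≤ L ^ (1 : ℝ) := Real.rpow_le_rpow_of_exponent_le hL1 (by norm_num)
        _ = L := Real.rpow_one _
    have h3 : (H X : ℝ) ≤ X := by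
      calc (H X : ℝ) ≤ Real.exp (L ^ (2 / 3 : ℝ)) := hHX
        _ ≤ Real.exp L := Real.exp_le_exp.mpr h2
        _ = X := by rw [hL]; exact Real.exp_log hX0'
    exact_mod_cast h3
  have hQP : (H X : ℝ) / L ^ (4 * A) < Real.exp (L ^ (2 / 3 + δ / 2)) := by
    have h1 : (H X : ℝ) / L ^ (4 * A) < H X := by
      rw [hW4, div_lt_iff₀ (by positivity)]
      have hW41 : 1 < W ^ 4 := by
        have : (2 : ℝ) ^ 4 ≤ W ^ 4 := pow_le_pow_left₀ (by norm_num) hW2X 4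
        linarith [show (16 : ℝ) = 2 ^ 4 by norm_num]
      nlinarith
    have h2 : (H X : ℝ) ≤ Real.exp (L ^ (2 / 3 + δ / 2)) :=
      hHX.trans (Real.exp_le_exp.mpr (Real.rpow_le_rpow_of_exponent_le hL1 (by linarith)))
    linarith
  rw [integral_window_div_eq_sum (fun s => ‖twistedSum g (s.filter
    (lichtmanTypical X A δ (H X))) α‖) X (H X) d hd]
  exact minorArc_sum_le (P₁ := L ^ (33 * A)) (Q₂ := Real.exp (L ^ (1 - δ / 2))) hW2X hd hdW hP₁
    hQ₁ hQP h3 hHleX (lichtmanTypical X A δ (H X)) (fun n => Iff.rfl) g hgmul hg hα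

end Literature.NumberTheory.Sieve.Lichtman2020

namespace Literature.NumberTheory.Sieve

open Filter Finset MeasureTheory Lichtman2020
open scoped Topology

/-- **Proposition 3.1 of Lichtman 2020 (key minor arc estimate), PROVED** in the vendored form
`Lichtman2020_minorArcEstimate` (`MoebiusShiftedPrimesArcs.lean`: all `δ ≥ 0`, regime
`H ≤ exp((log X)^{2/3})`, bound `C · HX/(d^{3/4} W^{1/5})` with `W = (log X)^A`): by
`minorArc_integral_le` the integral is at most `600 HX log H/(d√W)`, and
`log H ≤ (log X)^{2/3}`, `(log X)^{2/3 + A/5} ≤ (log X)^{A/2}` (`A > 5`, `log X ≥ 1`) and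
`d^{3/4} ≤ d` give `600 HX log H/(d√W) ≤ 600 HX/(d^{3/4} W^{1/5})`.  (The printed passage from (3.1)
to Proposition 3.1 loses for large `ψ`, see `Lichtman2020_minorArcBound31`; the proved bound, with
`1/d` in place of `1/√d`, does not.) [cite: Lichtman2020, Proposition 3.1] -/
theorem Lichtman2020_minorArcEstimate_holds : Lichtman2020_minorArcEstimate := by
  intro A hA δ hδ H hH hHexp
  have hA0 : 0 < A := by linarith
  refine ⟨600, ?_⟩
  filter_upwards [minorArc_integral_le A hA0 δ hδ H hH hHexp, hHexp, eventually_three_le_H hH,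
    tendsto_log_natCast.eventually_ge_atTop 1] with X hX hHX h3 hL1 d hd hdW g _hg1 hgmul hg α hα
  refine (hX d hd hdW g hgmul hg α hα).trans ?_
  set L : ℝ := Real.log X with hL
  have hL0 : 0 < L := by linarith
  have hH3 : (3 : ℝ) ≤ H X := by exact_mod_cast h3
  have hH0 : (0 : ℝ) < H X := by linarith
  have hd1 : (1 : ℝ) ≤ d := by exact_mod_cast hd
  have hd0 : (0 : ℝ) < d := by linarith
  have hlogH : Real.log (H X) ≤ L ^ (2 / 3 : ℝ) := by
    have := Real.log_le_log hH0 hHX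
    rwa [Real.log_exp] at this
  have hlogH0 : 0 ≤ Real.log (H X) := Real.log_nonneg (by linarith)
  have hsqrt : Real.sqrt (L ^ A) = L ^ (A / 2) := by
    rw [Real.sqrt_eq_rpow, ← Real.rpow_mul hL0.le]
    ring_nf
  have hd34 : (d : ℝ) ^ (3 / 4 : ℝ) ≤ d := by
    calc (d : ℝ) ^ (3 / 4 : ℝ) ≤ (d : ℝ) ^ (1 : ℝ) :=
          Real.rpow_le_rpow_of_exponent_le hd1 (by norm_num)
      _ = d := Real.rpow_one _
  have hkey : Real.log (H X) * L ^ (A / 5) ≤ L ^ (A / 2) := by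
    calc Real.log (H X) * L ^ (A / 5) ≤ L ^ (2 / 3 : ℝ) * L ^ (A / 5) :=
          mul_le_mul_of_nonneg_right hlogH (by positivity)
      _ = L ^ (2 / 3 + A / 5) := by rw [← Real.rpow_add hL0]
      _ ≤ L ^ (A / 2) := Real.rpow_le_rpow_of_exponent_le hL1 (by linarith)
  have hHX0 : 0 ≤ (H X : ℝ) * X := by positivity
  apply mul_le_mul_of_nonneg_left _ (by norm_num)
  rw [hsqrt, div_le_div_iff₀ (by positivity) (by positivity)]
  calc (H X : ℝ) * X * Real.log (H X) * ((d : ℝ) ^ (3 / 4 : ℝ) * L ^ (A / 5))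
      = (H X : ℝ) * X * ((d : ℝ) ^ (3 / 4 : ℝ) * (Real.log (H X) * L ^ (A / 5))) := by ring
    _ ≤ (H X : ℝ) * X * (d * L ^ (A / 2)) := by
        apply mul_le_mul_of_nonneg_left _ hHX0
        exact mul_le_mul hd34 hkey (by positivity) (by positivity)

/-- **Proposition 2.3 (regime `H ≤ exp((log X)^{2/3})`) from Proposition 3.2 alone**, the minor
arcs being the proved `Lichtman2020_minorArcEstimate_holds`.
[cite: Lichtman2020, Proposition 2.3 and §3, p. 9] -/
theorem Lichtman2020_keyFourierEstimateLiouville'_of_majorArcEstimate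
    (h32 : Lichtman2020_majorArcEstimate) : Lichtman2020_keyFourierEstimateLiouville' :=
  Lichtman2020_keyFourierEstimateLiouville'_of_arcs Lichtman2020_minorArcEstimate_holds h32

/-- **Theorem 2.2 (key Fourier estimate for `μ`) from Proposition 3.2 alone.**
[cite: Lichtman2020, Theorem 2.2] -/
theorem Lichtman2020_keyFourierEstimate_of_majorArcEstimate (h32 : Lichtman2020_majorArcEstimate) :
    Lichtman2020_keyFourierEstimate :=
  Lichtman2020_keyFourierEstimate_of_liouville'
    (Lichtman2020_keyFourierEstimateLiouville'_of_majorArcEstimate h32)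

/-- **Lichtman's Theorem 1.1 (qualitative part) from Proposition 3.2 alone** — the state of the
decomposition after this file: the minor arcs (Proposition 3.1), the passage to Proposition 2.3 and
Theorem 2.2, Lemma 2.1 and the sieve bound (2.5) are all proved; the major arc estimate
Proposition 3.2 (`Lichtman2020_majorArcEstimate`; in the paper from Proposition 3.4 ⇐ Proposition 5.1,
the Matomäki–Radziwiłł/Halász machinery with Vinogradov–Korobov) is the one remaining input.
[cite: Lichtman2020, Theorem 1.1] -/
theorem lichtman2020_moebius_shifted_primes_avg_of_majorArcEstimate
    (h32 : Lichtman2020_majorArcEstimate) : lichtman2020_moebius_shifted_primes_avg :=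
  lichtman2020_moebius_shifted_primes_avg_of_arcs' Lichtman2020_minorArcEstimate_holds h32

end Literature.NumberTheory.Sieve
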